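import Literature.AlgebraicGeometry.Shioda1982.KoblitzOgusRelationsTwentyPrime
import Literature.AlgebraicGeometry.Shioda1982.HodgeQuadruplesTenPrime
import HarnessLib

/-!
# The pair-free Hodge `4`-multisets of level `20p` (`p ≥ 19` prime) in Chinese-remainder coordinates

Topic `Literature/AlgebraicGeometry/Shioda1982`; the level `m = 20p = 4·5·p` of Shioda 1982, Lemma 1 / Prop. 4 (Q′) and Aoki–Shioda
1983, Theorem (𝔅²ₘ) (ii), one storey above the tree's `HodgeQuadruplesTenPrime` (`m = 10p`) and on top of the relations of
`KoblitzOgusRelationsTwentyPrime`: the first level of the series `2p, 4p, 10p, 20p` divisible by `20`, where Meyer–Neutsch's Tabelle 1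
has four rows (`N = 20`: the unit orbits of `(1, 4, 17, 18)`, `(1, 6, 16, 17)`, `(1, 9, 13, 17)`, `(1, 10, 12, 17)`, of sizes
`8, 8, 2, 8` — Shioda's `Δ(20) = 26`). THEOREM (no named fact, no `sorry`): **`classify_hodgeMultiset_twentyPrime`** — a pair-free
Hodge `4`-multiset `s` over `ℤ/20p`, `p ≥ 19` prime (`IsHodgeMultiset s`, Shioda's semigroup condition), is `{x, x + 10p, −2x, 10p}`
or `{x, x + 10p, 2x + 10p, −4x}` for some residue `x` (Shioda's `αᵢ, βᵢ` with `m′ = 10p`; `3 ∤ m`, so there is no `γ`), or `x·r`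
with `x = t·p`, `t ∈ {1, 3, 7, 9, 11, 13, 17, 19}`, and `r` one of the four representatives above (together: the `26` multiples by `p`
of the pair-free Hodge quadruples of level `20` outside the two standard families) [cite: Shioda1982PicardFermat, §4 Lemma 1 p. 728,
Prop. 4 (Q′) p. 729, table p. 727 (m = 20)]; [cite: AokiShioda1983, §2 Theorem (𝔅²ₘ) (ii) a), b)];
[cite: MeyerNeutsch1981Fermatquadrupel, Tabelle 1 p. 54 (N = 20)]. Also public: the transfer `isHodgeMultiset_transfer_twentyPrime`
(level `20p → 10p`). The bound `p ≥ 19` is inherited from `classify_hodgeMultiset_tenPrime`; the statement also holds at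
`p = 11, 13, 17` (cell `pub-hfermat`, brute force) and fails at `p = 7` (lifts of the levels `14` and `28`).

## The proof (ours — four character relations in Chinese-remainder coordinates, the transfer to level `10p`, and the norm equations
at the units `(1, λ)`; NOT the printed inductive-structure argument)

(1) RELATIONS. Of the eight relation families of `KoblitzOgusRelationsTwentyPrime` (from the tree's PROVED
`KoblitzOgus.hodge_eq_combination` [cite: Deligne1982HodgeCycles, Rem. 7.16 (a)]) only the four that see odd residues alone are used,
in the coordinates `ℤ/20p ≅ ℤ/20 × ℤ/p` (`crtPt20`): the single-fibre relations `Z1`, `Z3` (`relOneNine/relThreeSeven_twentyPrime`,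
`= 0`) and the constant families `Γ₋₄χ₅` (single fibre) and `Γ₋₄` (fibres `c, 5c`) (`gammaM4Chi5/gammaM4_twentyPrime`); for a
`4`-element multiset and `p ≥ 19` some parameter `c₀` has no member over `±c₀, ±5c₀`, so the constant ones vanish identically
(`exists_free`, `rels0_of_rels`) — elementary shadows of Aoki's criterion [cite: Aoki1983, Prop. 2.2]. They are evaluated on explicit
multisets through five tables mod `20` (`cZ1_cons`, …; `decide`d table lemmas). Two consequences: `two_odd_core` (an odd two-element
configuration `{x, y}` with `x` off the fibre `pℤ/20p` has `y = x + 10p` — instances `Z1(c)`, `Z3(c)`, `Γ₋₄χ₅(c)`, `Γ₋₄(c/5)`) and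
`halfpair_odd` (`{u₁, 10p − u₁, u₃, 10p − u₃}`, all odd, violates them). Only `n·a ≠ 0` in `ℤ/p` for `a ≠ 0` and `n ≤ 6` is used there.
(2) TRANSFER. For a unit `u` of `ℤ/20p` also `u(1 + 10p)` is one; adding the two norm equations shows that `T(s)` = (odd members
mod `10p`) + 2·((even members)/2 mod `10p`) is a Hodge multiset of level `10p` (`isHodgeMultiset_transfer_twentyPrime`, verbatim
the argument of `isHodgeMultiset_transfer_twentyFourPrime`), to which the tree's `classify_hodgeMultiset_tenPrime` applies.
(3) CASES by the number of odd members (even, since `Σ = 0`). All members in `pℤ/20p`: the norm equations at the units `pt(u, 1)`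
make `s/p` a pair-free Hodge quadruple of level `20`, and those (`42` multisets, `table20`: types α, β and the four exceptional orbits)
are enumerated by the kernel (`lev20_slice_1, …, lev20_slice_10`: `decide` over the pairs `(k₂, k₃) ∈ (ℤ/20)²` next to a member `k₁`
of least representative, `≤ 10`; `table20_forms`) — `fibre_zero`. No odd member: `T(s) = 2σ` with `σ` a pair-free Hodge quadruple of
level `10p`; double back (`case_all_even`). Two odd members `x, y`: if one is off `pℤ`, then `y = x + 10p` and `{x̄, ẑ, ŵ, 5p}` is a
Hodge quadruple of level `10p` — a pair in it means `s = α_x`, otherwise it is the level-`10p` `α_y` with `y ∈ {x̄, x̄ + 5p}` and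
`s = β_x` (`case_two_odd`; `5p ∉ β_y` is seen modulo `2`); both in `pℤ` is impossible (`case_two_odd_fibre`): the units `pt(1, λ)` fix
the odd members and move the even ones `pt(f, c)`, `pt(f′, −c)` to `pt(f, μ)`, `pt(f′, −μ)`, and writing `⟨pt(f, μ)⟩ = 20A + ⟨f⟩` the
norm equations make `A + B` independent of `μ ≠ 0`, whereas `B` is an affine function of `A` modulo `p` and `A + B` must jump by `p`
(`step_contra`, an argument on representatives needing only `p ≥ 11`; no relation is used). Four odd members: `s̄ = s mod 10p` is a
Hodge quadruple with odd members, hence not pair-free (the level-`10p` types have an even member), so `s` is a half-pair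
configuration, excluded by (1) (`case_all_odd`) — i.e. four odd members only occur inside `pℤ/20p`.
Numerical companions (cell `pub-hfermat`, outside Lean): `code/lit/picard/check20p.py` (g27: the eight families hold on all
`2659 / 6347 / 8797` Hodge `4`-multisets of the levels `140, 220, 260`), `code/lit/picard/brute20p.py` (g28, independent enumeration
against the statement: at `m = 220, 260, 340, 380, 460` the pair-free Hodge `4`-multisets are `(10p − 2)` α `+ (10p − 2)` β `+ 26`
lifted level-`20` quadruples, `0` other; at `m = 140` twelve more; the level-`20` table `42 = 8 + 8 + (8 + 8 + 2 + 8)`).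

HONEST FRAMING (cell `pub-hfermat`): explicit algebraic cycles for specific Hodge classes on Fermat/Delsarte varieties; residual open
instances listed; no claim on general Hodge. (This file reproduces a printed structure theorem; the proof route is this formalisation's.)

## References
* [Shioda1982PicardFermat] T. Shioda, *On the Picard number of a Fermat surface*, J. Fac. Sci. Univ. Tokyo IA **28** (1982) 725–734,
  §4 Lemma 1 p. 728, Prop. 4 (Q′) p. 729, table p. 727 (`Δ(20) = 26`).
* [AokiShioda1983] N. Aoki, T. Shioda, *Generators of the Néron–Severi group of a Fermat surface*, Progr. Math. 35 (1983), §2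
  Theorem (𝔅²ₘ) (ii).
* [MeyerNeutsch1981Fermatquadrupel] W. Meyer, W. Neutsch, *Fermatquadrupel*, Math. Ann. 256 (1981) 51–62, Tabelle 1 p. 54 (rows `N = 20`).
* [Aoki1983] N. Aoki, Math. Ann. 266 (1983) 23–54, Prop. 2.2.
* [Deligne1982HodgeCycles] P. Deligne, LNM 900 (1982), Rem. 7.16 (a) (Koblitz–Ogus), through `KoblitzOgusRelationsTwentyPrime`.
* [Shioda1979PJA] T. Shioda, Proc. Japan Acad. 55A (1979), §1 eq. (2) (the Hodge condition).
-/

namespace Literature.AlgebraicGeometry.Shioda1982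

open Finset Multiset
open Literature.AlgebraicGeometry.HodgeTheory Literature.AlgebraicGeometry.HodgeTheory.FermatCharacter

section TwentyPrimeClassification

variable {p : ℕ}

set_option linter.unusedSimpArgs false -- uniform simp sets across the case analyses (as in `HodgeQuadruplesTwentyFourPrime`)

/-! ### `ℤ/20p ≅ ℤ/20 × ℤ/p`: Chinese-remainder coordinates (as in `KoblitzOgusRelationsTwentyPrime`) -/

-- BEGIN DUP (verbatim pattern from KoblitzOgusRelationsTwentyPrime.lean / HodgeQuadruplesTwentyFourPrime.lean; private there)
/-- The Chinese-remainder isomorphism `ℤ/20p ≃+* ℤ/20 × ℤ/p`. [folklore] -/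
private def crt (h : Nat.Coprime 20 p) : ZMod (20 * p) ≃+* ZMod 20 × ZMod p := ZMod.chineseRemainder h

/-- The residue with coordinates `(e, b)`. [folklore] -/
private def pt (h : Nat.Coprime 20 p) (e : ZMod 20) (b : ZMod p) : ZMod (20 * p) := (crt h).symm (e, b)

/-- First coordinate = residue mod `20`. [folklore] -/
private theorem crt_fst (h : Nat.Coprime 20 p) [NeZero (20 * p)] (w : ZMod (20 * p)) :
    (crt h w).1 = (w.val : ZMod 20) := by
  conv_lhs => rw [← ZMod.natCast_zmod_val w]
  rw [map_natCast, Prod.fst_natCast]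

/-- Second coordinate = residue mod `p`. [folklore] -/
private theorem crt_snd (h : Nat.Coprime 20 p) [NeZero (20 * p)] (w : ZMod (20 * p)) :
    (crt h w).2 = (w.val : ZMod p) := by
  conv_lhs => rw [← ZMod.natCast_zmod_val w]
  rw [map_natCast, Prod.snd_natCast]

/-- `crt (pt e b) = (e, b)`. [folklore] -/
private theorem crt_pt (h : Nat.Coprime 20 p) (e : ZMod 20) (b : ZMod p) : crt h (pt h e b) = (e, b) :=
  (crt h).apply_symm_apply (e, b)

/-- `pt (crt w) = w`. [folklore] -/
private theorem pt_crt (h : Nat.Coprime 20 p) (w : ZMod (20 * p)) : pt h (crt h w).1 (crt h w).2 = w :=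
  (crt h).symm_apply_apply w

/-- `pt` is injective. [folklore] -/
private theorem pt_inj (h : Nat.Coprime 20 p) {e e' : ZMod 20} {b b' : ZMod p} :
    pt h e b = pt h e' b' ↔ e = e' ∧ b = b' := by
  rw [pt, pt, (crt h).symm.injective.eq_iff, Prod.mk.injEq]

/-- `pt` and negation. [folklore] -/
private theorem neg_pt (h : Nat.Coprime 20 p) (e : ZMod 20) (b : ZMod p) : -pt h e b = pt h (-e) (-b) := by
  rw [pt, pt, ← (crt h).symm.map_neg, Prod.neg_mk]

/-- `pt` and natural multiples. [folklore] -/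
private theorem natCast_mul_pt (h : Nat.Coprime 20 p) (k : ℕ) (e : ZMod 20) (b : ZMod p) :
    (k : ZMod (20 * p)) * pt h e b = pt h (k * e) (k * b) := by
  rw [pt, pt, ← nsmul_eq_mul, ← _root_.map_nsmul, Prod.smul_mk, nsmul_eq_mul, nsmul_eq_mul]
-- END DUP

/-- `(20, p) = 1` for a prime `p ≥ 7`. [folklore] -/
private theorem coprime_twenty (hp : p.Prime) (h7 : 7 ≤ p) : Nat.Coprime 20 p := by
  have h2 : Nat.Coprime 2 p := (Nat.coprime_primes Nat.prime_two hp).2 (by omega)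
  have h5 : Nat.Coprime 5 p := (Nat.coprime_primes (by decide) hp).2 (by omega)
  have h4 : Nat.Coprime 4 p := Nat.Coprime.mul_left h2 h2
  exact Nat.Coprime.mul_left h4 h5

/-- `pt` is additive. [folklore] -/
private theorem pt_add (h : Nat.Coprime 20 p) (e e' : ZMod 20) (b b' : ZMod p) :
    pt h e b + pt h e' b' = pt h (e + e') (b + b') := by
  rw [pt, pt, pt, ← (crt h).symm.map_add, Prod.mk_add_mk]

/-- `pt` is multiplicative. [folklore] -/
private theorem pt_mul (h : Nat.Coprime 20 p) (e e' : ZMod 20) (b b' : ZMod p) :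
    pt h e b * pt h e' b' = pt h (e * e') (b * b') := by
  rw [pt, pt, pt, ← (crt h).symm.map_mul, Prod.mk_mul_mk]

/-- `⟨pt e b⟩ mod 20` is `⟨e⟩`. [folklore] -/
private theorem val_pt_mod_twenty (h : Nat.Coprime 20 p) [NeZero (20 * p)] (e : ZMod 20) (b : ZMod p) :
    (pt h e b).val % 20 = e.val := by
  have := crt_fst h (pt h e b)
  rw [crt_pt] at this
  have h2 := congrArg ZMod.val this
  rw [ZMod.val_natCast] at h2
  exact h2.symm

/-- `⟨pt e b⟩ mod p` is `b`. [folklore] -/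
private theorem natCast_val_pt (h : Nat.Coprime 20 p) [NeZero (20 * p)] (e : ZMod 20) (b : ZMod p) :
    (((pt h e b).val : ℕ) : ZMod p) = b := by
  have := crt_snd h (pt h e b)
  rw [crt_pt] at this
  exact this.symm

/-- `⟨pt e b⟩ mod 2` is `⟨e⟩ mod 2`. [folklore] -/
private theorem val_pt_mod_two (h : Nat.Coprime 20 p) [NeZero (20 * p)] (e : ZMod 20) (b : ZMod p) :
    (pt h e b).val % 2 = e.val % 2 := by
  rw [← Nat.mod_mod_of_dvd _ (by norm_num : 2 ∣ 20), val_pt_mod_twenty]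

/-- The prime `p` as a residue mod `20`. -/
local notation "π" => ((p : ℕ) : ZMod 20)

/-- `crt p = (p mod 20, 0)`. [folklore] -/
private theorem crt_P (h : Nat.Coprime 20 p) [NeZero (20 * p)] : crt h (p : ZMod (20 * p)) = (π, 0) := by
  rw [Prod.ext_iff, crt_fst, crt_snd, ZMod.val_natCast]
  have hp20 : p % (20 * p) = p := Nat.mod_eq_of_lt (by have := NeZero.ne (20 * p); omega)
  rw [hp20]
  exact ⟨rfl, ZMod.natCast_self p⟩

/-- `p = pt (p mod 20) 0`. [folklore] -/
private theorem P_eq_pt (h : Nat.Coprime 20 p) [NeZero (20 * p)] : (p : ZMod (20 * p)) = pt h π 0 := by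
  rw [← pt_crt h (p : ZMod (20 * p)), crt_P]

/-- `p mod 20` is a unit residue for a prime `p ≥ 7`. [folklore] -/
private theorem pi_eq (hp : p.Prime) (h7 : 7 ≤ p) :
    π = 1 ∨ π = 3 ∨ π = 7 ∨ π = 9 ∨ π = 11 ∨ π = 13 ∨ π = 17 ∨ π = 19 := by
  have h2 : ¬ 2 ∣ p := fun h ↦ by
    have := (Nat.prime_dvd_prime_iff_eq Nat.prime_two hp).1 h; omega
  have h5 : ¬ 5 ∣ p := fun h ↦ by
    have := (Nat.prime_dvd_prime_iff_eq (by decide : Nat.Prime 5) hp).1 h; omega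
  have h20 : p % 20 = 1 ∨ p % 20 = 3 ∨ p % 20 = 7 ∨ p % 20 = 9 ∨ p % 20 = 11 ∨ p % 20 = 13 ∨ p % 20 = 17 ∨
      p % 20 = 19 := by omega
  rw [← ZMod.natCast_mod p 20]
  rcases h20 with e | e | e | e | e | e | e | e <;> rw [e]
  · exact Or.inl rfl
  · exact Or.inr (Or.inl rfl)
  · exact Or.inr (Or.inr (Or.inl rfl))
  · exact Or.inr (Or.inr (Or.inr (Or.inl rfl)))
  · exact Or.inr (Or.inr (Or.inr (Or.inr (Or.inl rfl))))
  · exact Or.inr (Or.inr (Or.inr (Or.inr (Or.inr (Or.inl rfl)))))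
  · exact Or.inr (Or.inr (Or.inr (Or.inr (Or.inr (Or.inr (Or.inl rfl))))))
  · exact Or.inr (Or.inr (Or.inr (Or.inr (Or.inr (Or.inr (Or.inr rfl))))))

/-- `10π = 10` in `ℤ/20` (`p` odd). [folklore] -/
private theorem ten_mul_pi (hp : p.Prime) (h7 : 7 ≤ p) : (10 : ZMod 20) * π = 10 := by
  rcases pi_eq hp h7 with h | h | h | h | h | h | h | h <;> rw [h] <;> decide

/-- `k·p = pt (kπ) 0`. [folklore] -/
private theorem natCast_mul_P (h : Nat.Coprime 20 p) [NeZero (20 * p)] (k : ℕ) :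
    ((k * p : ℕ) : ZMod (20 * p)) = pt h (k * π) 0 := by
  rw [Nat.cast_mul, P_eq_pt h, natCast_mul_pt, mul_zero]

/-- `10p = pt 10 0`. [folklore] -/
private theorem tenP_eq_pt (h : Nat.Coprime 20 p) [NeZero (20 * p)] (hp : p.Prime) (h7 : 7 ≤ p) :
    ((10 * p : ℕ) : ZMod (20 * p)) = pt h 10 0 := by
  rw [natCast_mul_P h, Nat.cast_ofNat, ten_mul_pi hp h7]

/-- `pt 1 1 = 1`. [folklore] -/
private theorem pt_one (h : Nat.Coprime 20 p) : pt h 1 1 = 1 := by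
  show (crt h).symm (1, 1) = 1
  exact _root_.map_one (crt h).symm

/-- `pt 0 0 = 0`. [folklore] -/
private theorem pt_zero (h : Nat.Coprime 20 p) : pt h 0 0 = 0 := by
  show (crt h).symm (0, 0) = 0
  exact _root_.map_zero (crt h).symm

/-- `pt u 1` is a unit when `u v = 1` in `ℤ/20`. [folklore] -/
private theorem isUnit_pt (h : Nat.Coprime 20 p) {u v : ZMod 20} (hu : u * v = 1) : IsUnit (pt h u 1) :=
  IsUnit.of_mul_eq_one (pt h v 1) (by rw [pt_mul, hu, mul_one, pt_one])

/-- `pt 1 b` is a unit for `b ≠ 0` (`p` prime). [folklore] -/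
private theorem isUnit_pt_one (h : Nat.Coprime 20 p) (hp : p.Prime) {b : ZMod p} (hb : b ≠ 0) : IsUnit (pt h 1 b) := by
  haveI := Fact.mk hp
  exact IsUnit.of_mul_eq_one (pt h 1 b⁻¹) (by rw [pt_mul, mul_one, mul_inv_cancel₀ hb, pt_one])

/-- The parity of the first coordinate is the parity of the residue. [folklore] -/
private theorem fst_val_mod_two (h : Nat.Coprime 20 p) [NeZero (20 * p)] (w : ZMod (20 * p)) :
    (crt h w).1.val % 2 = w.val % 2 := by
  rw [crt_fst, ZMod.val_natCast, Nat.mod_mod_of_dvd _ (by norm_num : 2 ∣ 20)]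

/-! ### Small multiples in `ℤ/p` -/

/-- `n ≠ 0` in `ℤ/p` for `0 < n < p`. [folklore] -/
private theorem natCast_ne_zero_of_lt {n : ℕ} (h0 : 0 < n) (hn : n < p) : (n : ZMod p) ≠ 0 := by
  intro h
  rw [ZMod.natCast_eq_zero_iff] at h
  exact absurd (Nat.le_of_dvd h0 h) (by omega)

/-- `n·a ≠ 0` for `a ≠ 0` and `0 < n < p` (`p` prime). [folklore] -/
private theorem mul_ne_zero_of_lt (hp : p.Prime) {a : ZMod p} (ha : a ≠ 0) {n : ℕ} (h0 : 0 < n) (hn : n < p) :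
    (n : ZMod p) * a ≠ 0 := by
  haveI := Fact.mk hp
  exact mul_ne_zero (natCast_ne_zero_of_lt h0 hn) ha

/-- `20 ≠ 0` in `ℤ/p` when `(20, p) = 1`, `p` prime. [folklore] -/
private theorem twenty_ne_zero (h : Nat.Coprime 20 p) (hp : p.Prime) : ((20 : ℕ) : ZMod p) ≠ 0 := by
  intro h0
  rw [ZMod.natCast_eq_zero_iff] at h0
  have h1 : p ∣ Nat.gcd 20 p := Nat.dvd_gcd h0 (dvd_refl p)
  rw [h] at h1
  exact hp.one_lt.ne' (Nat.dvd_one.mp h1)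

/-! ### The odd part in coordinates; the four functionals used and their tables mod `20` -/

/-- The odd part of the multiplicity function of `T : Multiset (ℤ/20 × ℤ/p)`: `o(q) = #_q T − #_{−q} T`. [folklore] -/
private def oc (T : Multiset (ZMod 20 × ZMod p)) (q : ZMod 20 × ZMod p) : ℤ := (count q T : ℤ) - count (-q) T

/-- `oddCt` at a coordinate point is the odd part of `s.map crt`. [folklore] -/
private theorem oddCt_crtPt20 (h : Nat.Coprime 20 p) (s : Multiset (ZMod (20 * p))) (e : ZMod 20) (c : ZMod p) :
    oddCt s (crtPt20 h e c) = oc (s.map (crt h)) (e, c) := by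
  classical
  have hc : ∀ q : ZMod 20 × ZMod p, count q (s.map (crt h)) = count ((crt h).symm q) s := fun q ↦ by
    rw [← Multiset.count_map_eq_count' _ _ (crt h).symm.injective, Multiset.map_map]
    simp only [Function.comp_def, RingEquiv.symm_apply_apply, Multiset.map_id']
  simp only [oddCt, oc, hc]
  show (count ((crt h).symm (e, c)) s : ℤ) - count (-(crt h).symm (e, c)) s =
    count ((crt h).symm (e, c)) s - count ((crt h).symm (-(e, c))) s
  rw [map_neg]

/-- Table of `Z1 = ô(1,·) − ô(9,·) − ô(11,·) + ô(19,·)` (even under `e ↦ −e`). [folklore] -/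
private def tZ1 (e : ZMod 20) : ℤ := if e.val = 1 ∨ e.val = 19 then 1 else if e.val = 9 ∨ e.val = 11 then -1 else 0

/-- Table of `Z3 = ô(3,·) − ô(7,·) − ô(13,·) + ô(17,·)` (even under `e ↦ −e`). [folklore] -/
private def tZ3 (e : ZMod 20) : ℤ := if e.val = 3 ∨ e.val = 17 then 1 else if e.val = 7 ∨ e.val = 13 then -1 else 0

/-- Table of `Γ₋₄χ₅ = Σ_{1,3,7,9} ô − Σ_{11,13,17,19} ô` (odd under `e ↦ −e`). [folklore] -/
private def tK (e : ZMod 20) : ℤ :=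
  if e.val = 1 ∨ e.val = 3 ∨ e.val = 7 ∨ e.val = 9 then 1
  else if e.val = 11 ∨ e.val = 13 ∨ e.val = 17 ∨ e.val = 19 then -1 else 0

/-- The odd character `χ₋₄` on the units of `ℤ/20` (`0` elsewhere). [folklore] -/
private def tU4 (e : ZMod 20) : ℤ :=
  if e.val = 1 ∨ e.val = 9 ∨ e.val = 13 ∨ e.val = 17 then 1
  else if e.val = 3 ∨ e.val = 7 ∨ e.val = 11 ∨ e.val = 19 then -1 else 0

/-- The weight of a residue in the fibre `5c` of `Γ₋₄`: `4·([e = 5] − [e = 15]) − χ₋₄(e)`. [folklore] -/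
private def tG (e : ZMod 20) : ℤ := if e.val = 5 then 4 else if e.val = 15 then -4 else -tU4 e

variable (T : Multiset (ZMod 20 × ZMod p))

/-- `Z1(b) = ô(1,b) − ô(9,b) − ô(11,b) + ô(19,b)` in coordinates. [folklore] -/
private def cZ1 (b : ZMod p) : ℤ := oc T (1, b) - oc T (9, b) - oc T (11, b) + oc T (19, b)

/-- `Z3(b) = ô(3,b) − ô(7,b) − ô(13,b) + ô(17,b)` in coordinates. [folklore] -/
private def cZ3 (b : ZMod p) : ℤ := oc T (3, b) - oc T (7, b) - oc T (13, b) + oc T (17, b)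

/-- `Γ₋₄χ₅(b)` in coordinates (the tree's `gammaM4Chi5Sum20`). [folklore] -/
private def cK (b : ZMod p) : ℤ :=
  oc T (1, b) + oc T (3, b) + oc T (7, b) + oc T (9, b) - oc T (11, b) - oc T (13, b) - oc T (17, b) - oc T (19, b)

/-- `Γ₋₄(b)` in coordinates (the tree's `gammaM4Sum20`; fibres `b`, `5b`). [folklore] -/
private def cG4 (b : ZMod p) : ℤ :=
  oc T (1, b) - oc T (3, b) - oc T (7, b) + oc T (9, b) - oc T (11, b) + oc T (13, b) + oc T (17, b) - oc T (19, b) -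
    oc T (1, 5 * b) + oc T (3, 5 * b) + oc T (7, 5 * b) - oc T (9, 5 * b) + oc T (11, 5 * b) - oc T (13, 5 * b) -
    oc T (17, 5 * b) + oc T (19, 5 * b) + 4 * oc T (5, 5 * b) - 4 * oc T (15, 5 * b)

/-- The four relation families used, on the coordinates of a Hodge multiset of level `20p`: `Z1 = Z3 = 0` fibrewise,
`Γ₋₄χ₅` and `Γ₋₄` constant. [folklore] -/
private structure Rels (T : Multiset (ZMod 20 × ZMod p)) : Prop where
  z1 : ∀ b : ZMod p, b ≠ 0 → cZ1 T b = 0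
  z3 : ∀ b : ZMod p, b ≠ 0 → cZ3 T b = 0
  k : ∀ b b' : ZMod p, b ≠ 0 → b' ≠ 0 → cK T b = cK T b'
  g4 : ∀ b b' : ZMod p, b ≠ 0 → b' ≠ 0 → cG4 T b = cG4 T b'

/-- The same with `Γ₋₄χ₅ ≡ 0`, `Γ₋₄ ≡ 0`. [folklore] -/
private structure Rels0 (T : Multiset (ZMod 20 × ZMod p)) : Prop where
  z1 : ∀ b : ZMod p, b ≠ 0 → cZ1 T b = 0
  z3 : ∀ b : ZMod p, b ≠ 0 → cZ3 T b = 0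
  k : ∀ b : ZMod p, b ≠ 0 → cK T b = 0
  g4 : ∀ b : ZMod p, b ≠ 0 → cG4 T b = 0

variable {T}

/-- **The relations `Z1`, `Z3`, `Γ₋₄χ₅`, `Γ₋₄` for the coordinates of a Hodge multiset of level `20p`** (the tree's
`relOneNine/relThreeSeven/gammaM4Chi5/gammaM4_twentyPrime`). [cite: Deligne1982HodgeCycles, Rem. 7.16 (a)] [cite: Aoki1983, Prop. 2.2] -/
private theorem rels_of_isHodgeMultiset (h : Nat.Coprime 20 p) [NeZero (20 * p)] (hp : p.Prime) (h7 : 7 ≤ p)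
    {s : Multiset (ZMod (20 * p))} (hs : IsHodgeMultiset s) : Rels (s.map (crt h)) := by
  refine ⟨fun b hb ↦ ?_, fun b hb ↦ ?_, fun b b' hb hb' ↦ ?_, fun b b' hb hb' ↦ ?_⟩
  · have key := relOneNine_twentyPrime hp h7 h hs hb
    simp only [oddCt_crtPt20] at key
    simp only [cZ1]
    linear_combination key
  · have key := relThreeSeven_twentyPrime hp h7 h hs hb
    simp only [oddCt_crtPt20] at key
    simp only [cZ3]
    linear_combination key
  · have key := gammaM4Chi5_twentyPrime hp h7 h hs hb hb'
    simp only [gammaM4Chi5Sum20, oddCt_crtPt20] at key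
    simp only [cK]
    linear_combination key
  · have key := gammaM4_twentyPrime hp h7 h hs hb hb'
    simp only [gammaM4Sum20, oddCt_crtPt20] at key
    simp only [cG4]
    linear_combination key

/-! ### `Γ ≡ 0`: a parameter whose fibres carry no member -/

/-- `o(u, x) = 0` when no member lies over `±x`. [folklore] -/
private theorem oc_eq_zero_of_free {T : Multiset (ZMod 20 × ZMod p)} {x : ZMod p}
    (hx : ∀ q ∈ T, q.2 ≠ x ∧ q.2 ≠ -x) (u : ZMod 20) : oc T (u, x) = 0 := by
  classical
  have h1 : count (u, x) T = 0 := Multiset.count_eq_zero.mpr fun hm ↦ (hx _ hm).1 rfl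
  have h2 : count (-u, -x) T = 0 := Multiset.count_eq_zero.mpr fun hm ↦ (hx _ hm).2 rfl
  simp [oc, Prod.neg_mk, h1, h2]

/-- **For a `4`-element coordinate multiset and `p ≥ 19` some `c₀ ≠ 0` has no member over `±c₀, ±5c₀`** (at most `16`
parameters are excluded). [folklore] -/
private theorem exists_free (hp : p.Prime) (h19 : 19 ≤ p) (T : Multiset (ZMod 20 × ZMod p)) (hT : card T = 4) :
    ∃ c : ZMod p, c ≠ 0 ∧ (∀ q ∈ T, q.2 ≠ c ∧ q.2 ≠ -c) ∧ ∀ q ∈ T, q.2 ≠ 5 * c ∧ q.2 ≠ -(5 * c) := by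
  classical
  haveI := Fact.mk hp
  have h5 : (5 : ZMod p) ≠ 0 := by exact_mod_cast natCast_ne_zero_of_lt (p := p) (n := 5) (by norm_num) (by omega)
  let B : Finset (ZMod p) := {0} ∪ ((T.map fun q ↦ q.2).toFinset ∪ (T.map fun q ↦ -q.2).toFinset ∪
      ((T.map fun q ↦ 5⁻¹ * q.2).toFinset ∪ (T.map fun q ↦ -(5⁻¹ * q.2)).toFinset))
  have hB : B.card ≤ 17 := by
    have c1 : ∀ g : ZMod 20 × ZMod p → ZMod p, ((T.map g).toFinset).card ≤ 4 := fun g ↦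
      (Multiset.toFinset_card_le _).trans (by rw [Multiset.card_map, hT])
    calc B.card ≤ ({0} : Finset (ZMod p)).card + (((T.map fun q ↦ q.2).toFinset ∪ (T.map fun q ↦ -q.2).toFinset ∪
          ((T.map fun q ↦ 5⁻¹ * q.2).toFinset ∪ (T.map fun q ↦ -(5⁻¹ * q.2)).toFinset))).card := Finset.card_union_le _ _
      _ ≤ 1 + (4 + 4 + (4 + 4)) := by
          gcongr
          · simp
          · exact (Finset.card_union_le _ _).trans (add_le_add ((Finset.card_union_le _ _).trans (add_le_add (c1 _) (c1 _)))
              ((Finset.card_union_le _ _).trans (add_le_add (c1 _) (c1 _))))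
      _ = 17 := by norm_num
  by_contra hcon
  push Not at hcon
  have hsub : (Finset.univ : Finset (ZMod p)) ⊆ B := by
    intro c _
    by_cases hc0 : c = 0
    · simp [B, hc0]
    have hc := hcon c hc0
    simp only [B, Finset.mem_union, Finset.mem_singleton, Multiset.mem_toFinset, Multiset.mem_map]
    by_cases hA : ∀ q ∈ T, q.2 ≠ c ∧ q.2 ≠ -c
    · obtain ⟨q, hq, hq'⟩ := hc hA
      by_cases e1 : q.2 = 5 * c
      · right; right; left; exact ⟨q, hq, by rw [e1, inv_mul_cancel_left₀ h5]⟩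
      · have e2 : q.2 = -(5 * c) := hq' e1
        right; right; right; exact ⟨q, hq, by rw [e2, mul_neg, inv_mul_cancel_left₀ h5, neg_neg]⟩
    · push Not at hA
      obtain ⟨q, hq, hq'⟩ := hA
      by_cases e1 : q.2 = c
      · right; left; left; exact ⟨q, hq, e1⟩
      · right; left; right; exact ⟨q, hq, by rw [hq' e1, neg_neg]⟩
  have := Finset.card_le_card hsub
  rw [Finset.card_univ, ZMod.card] at this
  omega

/-- **`Γ₋₄χ₅ ≡ 0`, `Γ₋₄ ≡ 0`** for a `4`-element coordinate multiset with the relations, `p ≥ 19`. [folklore] -/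
private theorem rels0_of_rels (hp : p.Prime) (h19 : 19 ≤ p) {T : Multiset (ZMod 20 × ZMod p)} (hT : card T = 4)
    (hR : Rels T) : Rels0 T := by
  obtain ⟨c₀, hc₀, hA, hB⟩ := exists_free hp h19 T hT
  have hk : cK T c₀ = 0 := by simp only [cK, oc_eq_zero_of_free hA]; ring
  have hg : cG4 T c₀ = 0 := by simp only [cG4, oc_eq_zero_of_free hA, oc_eq_zero_of_free hB]; ring
  exact ⟨hR.z1, hR.z3, fun c hc ↦ by rw [hR.k c c₀ hc hc₀, hk], fun c hc ↦ by rw [hR.g4 c c₀ hc hc₀, hg]⟩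

/-! ### Evaluating the functionals on explicit multisets: member contributions -/

/-- `o` of the empty multiset. [folklore] -/
private theorem oc_zero (q : ZMod 20 × ZMod p) : oc (0 : Multiset (ZMod 20 × ZMod p)) q = 0 := by simp [oc]

/-- `o` of `a ::ₘ T`. [folklore] -/
private theorem oc_cons (a : ZMod 20 × ZMod p) (T : Multiset (ZMod 20 × ZMod p)) (q : ZMod 20 × ZMod p) :
    oc (a ::ₘ T) q = oc T q + ((if q = a then 1 else 0) - (if -q = a then 1 else 0)) := by
  simp only [oc, Multiset.count_cons, Nat.cast_add, Nat.cast_ite, Nat.cast_one, Nat.cast_zero]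
  ring

/-- The contribution of a member `(f, d)` to `Z1(b)` (even brackets). [folklore] -/
private theorem cZ1_cons (f : ZMod 20) (d : ZMod p) (T : Multiset (ZMod 20 × ZMod p)) (b : ZMod p) :
    cZ1 ((f, d) ::ₘ T) b = cZ1 T b + tZ1 f * ((if b = d then 1 else 0) - (if -b = d then 1 else 0)) := by
  simp only [cZ1, oc_cons, Prod.mk.injEq, Prod.neg_mk]
  fin_cases f <;> simp +decide [tZ1] <;> split_ifs <;> omega

/-- The contribution of a member `(f, d)` to `Z3(b)` (even brackets). [folklore] -/
private theorem cZ3_cons (f : ZMod 20) (d : ZMod p) (T : Multiset (ZMod 20 × ZMod p)) (b : ZMod p) :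
    cZ3 ((f, d) ::ₘ T) b = cZ3 T b + tZ3 f * ((if b = d then 1 else 0) - (if -b = d then 1 else 0)) := by
  simp only [cZ3, oc_cons, Prod.mk.injEq, Prod.neg_mk]
  fin_cases f <;> simp +decide [tZ3] <;> split_ifs <;> omega

/-- The contribution of a member `(f, d)` to `Γ₋₄χ₅(b)` (odd brackets). [folklore] -/
private theorem cK_cons (f : ZMod 20) (d : ZMod p) (T : Multiset (ZMod 20 × ZMod p)) (b : ZMod p) :
    cK ((f, d) ::ₘ T) b = cK T b + tK f * ((if b = d then 1 else 0) + (if -b = d then 1 else 0)) := by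
  simp only [cK, oc_cons, Prod.mk.injEq, Prod.neg_mk]
  fin_cases f <;> simp +decide [tK] <;> split_ifs <;> omega

/-- The contribution of a member `(f, d)` to `Γ₋₄(b)` (odd brackets at `b` and `5b`). [folklore] -/
private theorem cG4_cons (f : ZMod 20) (d : ZMod p) (T : Multiset (ZMod 20 × ZMod p)) (b : ZMod p) :
    cG4 ((f, d) ::ₘ T) b = cG4 T b + tU4 f * ((if b = d then 1 else 0) + (if -b = d then 1 else 0)) +
      tG f * ((if 5 * b = d then 1 else 0) + (if -(5 * b) = d then 1 else 0)) := by
  simp only [cG4, oc_cons, Prod.mk.injEq, Prod.neg_mk]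
  fin_cases f <;> simp +decide [tG, tU4] <;> split_ifs <;> omega

/-- `cZ1` of the empty multiset. [folklore] -/
private theorem cZ1_zero (b : ZMod p) : cZ1 (0 : Multiset (ZMod 20 × ZMod p)) b = 0 := by simp [cZ1, oc_zero]

/-- `cZ3` of the empty multiset. [folklore] -/
private theorem cZ3_zero (b : ZMod p) : cZ3 (0 : Multiset (ZMod 20 × ZMod p)) b = 0 := by simp [cZ3, oc_zero]

/-- `cK` of the empty multiset. [folklore] -/
private theorem cK_zero (b : ZMod p) : cK (0 : Multiset (ZMod 20 × ZMod p)) b = 0 := by simp [cK, oc_zero]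

/-- `cG4` of the empty multiset. [folklore] -/
private theorem cG4_zero (b : ZMod p) : cG4 (0 : Multiset (ZMod 20 × ZMod p)) b = 0 := by simp [cG4, oc_zero]

/-- `cZ1` of a singleton. [folklore] -/
private theorem cZ1_singleton (f : ZMod 20) (d : ZMod p) (b : ZMod p) :
    cZ1 ({(f, d)} : Multiset (ZMod 20 × ZMod p)) b = tZ1 f * ((if b = d then 1 else 0) - (if -b = d then 1 else 0)) := by
  rw [← Multiset.cons_zero, cZ1_cons, cZ1_zero, zero_add]

/-- `cZ3` of a singleton. [folklore] -/
private theorem cZ3_singleton (f : ZMod 20) (d : ZMod p) (b : ZMod p) :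
    cZ3 ({(f, d)} : Multiset (ZMod 20 × ZMod p)) b = tZ3 f * ((if b = d then 1 else 0) - (if -b = d then 1 else 0)) := by
  rw [← Multiset.cons_zero, cZ3_cons, cZ3_zero, zero_add]

/-- `cK` of a singleton. [folklore] -/
private theorem cK_singleton (f : ZMod 20) (d : ZMod p) (b : ZMod p) :
    cK ({(f, d)} : Multiset (ZMod 20 × ZMod p)) b = tK f * ((if b = d then 1 else 0) + (if -b = d then 1 else 0)) := by
  rw [← Multiset.cons_zero, cK_cons, cK_zero, zero_add]

/-- `cG4` of a singleton. [folklore] -/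
private theorem cG4_singleton (f : ZMod 20) (d : ZMod p) (b : ZMod p) :
    cG4 ({(f, d)} : Multiset (ZMod 20 × ZMod p)) b = tU4 f * ((if b = d then 1 else 0) + (if -b = d then 1 else 0)) +
      tG f * ((if 5 * b = d then 1 else 0) + (if -(5 * b) = d then 1 else 0)) := by
  rw [← Multiset.cons_zero, cG4_cons, cG4_zero, zero_add]

/-! ### Finite facts about the tables mod `20` -/

/-- A bracket sum `[A] + [B]` is `0`, `1` or `2`. [folklore] -/
private theorem bracket_add_cases (A B : Prop) [Decidable A] [Decidable B] :
    ((if A then (1 : ℤ) else 0) + (if B then 1 else 0)) = 0 ∨ ((if A then (1 : ℤ) else 0) + (if B then 1 else 0)) = 1 ∨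
      ((if A then (1 : ℤ) else 0) + (if B then 1 else 0)) = 2 := by
  by_cases hA : A <;> by_cases hB : B <;> simp [hA, hB]

/-- Reflected brackets, even type: `[b = −d] − [−b = −d] = −([b = d] − [−b = d])`. [folklore] -/
private theorem brkE (b d : ZMod p) :
    ((if b = -d then (1 : ℤ) else 0) - (if -b = -d then 1 else 0)) = -((if b = d then 1 else 0) - (if -b = d then 1 else 0)) := by
  have e1 : (b = -d) = (-b = d) := propext ⟨fun h ↦ by rw [h, neg_neg], fun h ↦ by rw [← h, neg_neg]⟩
  have e2 : (-b = -d) = (b = d) := propext neg_inj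
  simp only [e1, e2]; ring

/-- Reflected brackets, odd type: `[b = −d] + [−b = −d] = [b = d] + [−b = d]`. [folklore] -/
private theorem brkO (b d : ZMod p) :
    ((if b = -d then (1 : ℤ) else 0) + (if -b = -d then 1 else 0)) = ((if b = d then 1 else 0) + (if -b = d then 1 else 0)) := by
  have e1 : (b = -d) = (-b = d) := propext ⟨fun h ↦ by rw [h, neg_neg], fun h ↦ by rw [← h, neg_neg]⟩
  have e2 : (-b = -d) = (b = d) := propext neg_inj
  simp only [e1, e2]; ring

/-- Table (generic fibre): for odd `e` invisible to `Z1`, `Z3`, `Γ₋₄χ₅` (so `e ∈ {5, 15}`) the weight `4·(±1)` at the fibre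
`5d = c` is not cancelled by one unit member. [folklore] -/
private theorem tab_gen {e e' : ZMod 20} (he : e.val % 2 = 1) (h1 : tZ1 e = 0) (h3 : tZ3 e = 0) (hk : tK e = 0) :
    tG e + tU4 e' * 0 ≠ 0 ∧ tG e + tU4 e' * 1 ≠ 0 ∧ tG e + tU4 e' * 2 ≠ 0 := by
  revert e e' he h1 h3 hk; decide

/-- Table (same fibre): the relations for two odd members `(e, c), (e′, c)` force `e′ = e + 10`. [folklore] -/
private theorem tab_shift {e e' : ZMod 20} (he : e.val % 2 = 1) (he' : e'.val % 2 = 1) (h1 : tZ1 e + tZ1 e' = 0)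
    (h3 : tZ3 e + tZ3 e' = 0) (hk : tK e + tK e' = 0) (hg : tG e + tG e' = 0) : e' = e + 10 := by
  revert e e' he he' h1 h3 hk hg; decide

/-- Table (opposite fibres): the relations for two odd members `(e, c), (e′, −c)` force `e′ = −e`. [folklore] -/
private theorem tab_neg {e e' : ZMod 20} (he : e.val % 2 = 1) (he' : e'.val % 2 = 1) (h1 : tZ1 e = tZ1 e')
    (h3 : tZ3 e = tZ3 e') (hk : tK e + tK e' = 0) (hg : tG e + tG e' = 0) : e' = -e := by
  revert e e' he he' h1 h3 hk hg; decide

/-- Table (reflection `f ↦ 10 − f` of an odd residue): the even tables change sign, the odd ones do not. [folklore] -/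
private theorem tab_reflect {f : ZMod 20} (hf : f.val % 2 = 1) :
    tZ1 (10 - f) = -tZ1 f ∧ tZ3 (10 - f) = -tZ3 f ∧ tK (10 - f) = tK f ∧ tU4 (10 - f) = tU4 f ∧ tG (10 - f) = tG f := by
  revert f hf; decide

/-- The tables vanish on an even residue. [folklore] -/
private theorem even_tables {f : ZMod 20} (hf : f.val % 2 = 0) :
    tZ1 f = 0 ∧ tZ3 f = 0 ∧ tK f = 0 ∧ tU4 f = 0 ∧ tG f = 0 := by
  revert f hf; decide

/-- Even members are invisible to the four relations. [folklore] -/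
private theorem Rels0.of_cons_even {q : ZMod 20 × ZMod p} {T : Multiset (ZMod 20 × ZMod p)} (h : Rels0 (q ::ₘ T))
    (hq : q.1.val % 2 = 0) : Rels0 T := by
  obtain ⟨f, d⟩ := q
  obtain ⟨h1, h3, hk, hu, hg⟩ := even_tables (f := f) hq
  refine ⟨fun b hb ↦ ?_, fun b hb ↦ ?_, fun b hb ↦ ?_, fun b hb ↦ ?_⟩
  · have := h.z1 b hb
    rw [cZ1_cons, h1, zero_mul, add_zero] at this
    exact this
  · have := h.z3 b hb
    rw [cZ3_cons, h3, zero_mul, add_zero] at this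
    exact this
  · have := h.k b hb
    rw [cK_cons, hk, zero_mul, add_zero] at this
    exact this
  · have := h.g4 b hb
    rw [cG4_cons, hu, hg, zero_mul, zero_mul, add_zero, add_zero] at this
    exact this

/-! ### Two odd members: the shift `x ↦ x + 10p` -/

/-- **Periodicity for a two-element odd configuration.** If `O = {x, y}` (both odd) satisfies `Z1 = Z3 = Γ₋₄χ₅ = Γ₋₄ = 0`,
`x = (e, c)` with `c ≠ 0` and `y ≠ −x`, then `y = (e + 10, c)` (`= x + 10p` in `ℤ/20p`). Instances used: `Z1`, `Z3`, `Γ₋₄χ₅` at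
`c` (fibres `±c`) and `Γ₋₄` at `d = c/5` (fibres `±d, ±c`); the fibre of `y` is `c`, `−c` or generic. [folklore] -/
private theorem two_odd_core (hp : p.Prime) (h19 : 19 ≤ p) {O : Multiset (ZMod 20 × ZMod p)} (hO : Rels0 O)
    {e e' : ZMod 20} {c c' : ZMod p} (hOe : O = {(e, c), (e', c')}) (he : e.val % 2 = 1) (he' : e'.val % 2 = 1) (hc : c ≠ 0)
    (hyx : ((e', c') : ZMod 20 × ZMod p) ≠ -(e, c)) : e' = e + 10 ∧ c' = c := by
  haveI := Fact.mk hp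
  have h5 : (5 : ZMod p) ≠ 0 := by exact_mod_cast natCast_ne_zero_of_lt (p := p) (n := 5) (by norm_num) (by omega)
  have h2c : (2 : ZMod p) * c ≠ 0 := by exact_mod_cast mul_ne_zero_of_lt hp hc (n := 2) (by norm_num) (by omega)
  -- `d` with `5d = c`
  set d : ZMod p := (5 : ZMod p)⁻¹ * c with hd
  have h5d : 5 * d = c := by rw [hd, ← mul_assoc, mul_inv_cancel₀ h5, one_mul]
  have hd0 : d ≠ 0 := fun h0 ↦ hc (by rw [← h5d, h0, mul_zero])
  have h4d : (4 : ZMod p) * d ≠ 0 := by exact_mod_cast mul_ne_zero_of_lt hp hd0 (n := 4) (by norm_num) (by omega)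
  have h6d : (6 : ZMod p) * d ≠ 0 := by exact_mod_cast mul_ne_zero_of_lt hp hd0 (n := 6) (by norm_num) (by omega)
  -- non-coincidences of the fibres `c, −c, d, −d`
  have hcc : -c ≠ c := fun h ↦ h2c (by linear_combination -h)
  have hcc' : c ≠ -c := fun h ↦ h2c (by linear_combination h)
  have ndc : d ≠ c := fun h ↦ h4d (by linear_combination h5d - h)
  have nmdc : -d ≠ c := fun h ↦ h6d (by linear_combination h5d - h)
  have ndmc : d ≠ -c := fun h ↦ h6d (by linear_combination h5d + h)
  have nmdmc : -d ≠ -c := fun h ↦ ndc (neg_inj.mp h)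
  have n5dmc : -(5 * d) ≠ c := by rw [h5d]; exact hcc
  -- expansions on `O = {(e,c), (e',c')}`
  have EZ1 : ∀ b, cZ1 O b = tZ1 e * ((if b = c then 1 else 0) - (if -b = c then 1 else 0)) +
      tZ1 e' * ((if b = c' then 1 else 0) - (if -b = c' then 1 else 0)) := fun b ↦ by
    rw [hOe, Multiset.insert_eq_cons, cZ1_cons, cZ1_singleton]; ring
  have EZ3 : ∀ b, cZ3 O b = tZ3 e * ((if b = c then 1 else 0) - (if -b = c then 1 else 0)) +
      tZ3 e' * ((if b = c' then 1 else 0) - (if -b = c' then 1 else 0)) := fun b ↦ by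
    rw [hOe, Multiset.insert_eq_cons, cZ3_cons, cZ3_singleton]; ring
  have EK : ∀ b, cK O b = tK e * ((if b = c then 1 else 0) + (if -b = c then 1 else 0)) +
      tK e' * ((if b = c' then 1 else 0) + (if -b = c' then 1 else 0)) := fun b ↦ by
    rw [hOe, Multiset.insert_eq_cons, cK_cons, cK_singleton]; ring
  have EG : ∀ b, cG4 O b = tU4 e * ((if b = c then 1 else 0) + (if -b = c then 1 else 0)) +
      tG e * ((if 5 * b = c then 1 else 0) + (if -(5 * b) = c then 1 else 0)) +
      (tU4 e' * ((if b = c' then 1 else 0) + (if -b = c' then 1 else 0)) +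
      tG e' * ((if 5 * b = c' then 1 else 0) + (if -(5 * b) = c' then 1 else 0))) := fun b ↦ by
    rw [hOe, Multiset.insert_eq_cons, cG4_cons, cG4_singleton]; ring
  have hZ1 := hO.z1 c hc
  have hZ3 := hO.z3 c hc
  have hK := hO.k c hc
  have hG := hO.g4 d hd0
  rw [EZ1] at hZ1
  rw [EZ3] at hZ3
  rw [EK] at hK
  rw [EG] at hG
  by_cases h1 : c' = c
  · subst c'
    simp only [h5d, if_true, if_false, hcc, ndc, nmdc, n5dmc] at hZ1 hZ3 hK hG
    exact ⟨tab_shift he he' (by linarith) (by linarith) (by linarith) (by linarith), rfl⟩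
  by_cases h2 : c' = -c
  · subst c'
    exfalso
    simp only [h5d, if_true, if_false, hcc, hcc', ndc, nmdc, ndmc, nmdmc, n5dmc, neg_inj] at hZ1 hZ3 hK hG
    have key := tab_neg he he' (by linarith) (by linarith) (by linarith) (by linarith)
    exact hyx (by rw [key, Prod.neg_mk])
  · exfalso
    have h1' : c ≠ c' := fun h ↦ h1 h.symm
    have h2' : -c ≠ c' := fun h ↦ h2 h.symm
    have h3' : -(5 * d) ≠ c' := by rw [h5d]; exact h2'
    simp only [h5d, if_true, if_false, hcc, h1', h2', h3', ndc, nmdc, n5dmc, mul_zero, add_zero, sub_zero, mul_one,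
      zero_add] at hZ1 hZ3 hK hG
    obtain ⟨g0, g1, g2⟩ := tab_gen (e' := e') he hZ1 hZ3 hK
    rcases bracket_add_cases (d = c') (-d = c') with hb | hb | hb <;> rw [hb] at hG
    · exact g0 (by linarith)
    · exact g1 (by linarith)
    · exact g2 (by linarith)

/-- The relations of a 'half-pair' configuration `{x, 10p − x, y, 10p − y}` (all odd) are twice those of `{x, y}`. [folklore] -/
private theorem rels0_halfpair {e f : ZMod 20} {c c' : ZMod p} (he : e.val % 2 = 1) (hf : f.val % 2 = 1)
    (hH : Rels0 ({(e, c), (10 - e, -c), (f, c'), (10 - f, -c')} : Multiset (ZMod 20 × ZMod p))) :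
    Rels0 ({(e, c), (f, c')} : Multiset (ZMod 20 × ZMod p)) := by
  obtain ⟨r1, r3, rk, ru, rg⟩ := tab_reflect he
  obtain ⟨r1', r3', rk', ru', rg'⟩ := tab_reflect hf
  have k1 : ∀ b, cZ1 ({(e, c), (10 - e, -c), (f, c'), (10 - f, -c')} : Multiset (ZMod 20 × ZMod p)) b =
      2 * cZ1 ({(e, c), (f, c')} : Multiset (ZMod 20 × ZMod p)) b := fun b ↦ by
    simp only [Multiset.insert_eq_cons, cZ1_cons, cZ1_singleton, r1, r1', brkE]; ring
  have k3 : ∀ b, cZ3 ({(e, c), (10 - e, -c), (f, c'), (10 - f, -c')} : Multiset (ZMod 20 × ZMod p)) b =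
      2 * cZ3 ({(e, c), (f, c')} : Multiset (ZMod 20 × ZMod p)) b := fun b ↦ by
    simp only [Multiset.insert_eq_cons, cZ3_cons, cZ3_singleton, r3, r3', brkE]; ring
  have kk : ∀ b, cK ({(e, c), (10 - e, -c), (f, c'), (10 - f, -c')} : Multiset (ZMod 20 × ZMod p)) b =
      2 * cK ({(e, c), (f, c')} : Multiset (ZMod 20 × ZMod p)) b := fun b ↦ by
    simp only [Multiset.insert_eq_cons, cK_cons, cK_singleton, rk, rk', brkO]; ring
  have kg : ∀ b, cG4 ({(e, c), (10 - e, -c), (f, c'), (10 - f, -c')} : Multiset (ZMod 20 × ZMod p)) b =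
      2 * cG4 ({(e, c), (f, c')} : Multiset (ZMod 20 × ZMod p)) b := fun b ↦ by
    simp only [Multiset.insert_eq_cons, cG4_cons, cG4_singleton, ru, ru', rg, rg', brkO]; ring
  refine ⟨fun b hb ↦ ?_, fun b hb ↦ ?_, fun b hb ↦ ?_, fun b hb ↦ ?_⟩
  · have := hH.z1 b hb
    rw [k1] at this
    linarith
  · have := hH.z3 b hb
    rw [k3] at this
    linarith
  · have := hH.k b hb
    rw [kk] at this
    linarith
  · have := hH.g4 b hb
    rw [kg] at this
    linarith

/-- **No half-pair configuration.** `{x, 10p − x, y, 10p − y}` with `x = (e, c)` odd off the fibre `0`, `y` odd, `y ≠ −x`,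
`10p − y ≠ −x`, violates the relations. [folklore] -/
private theorem halfpair_odd (hp : p.Prime) (h19 : 19 ≤ p) {e f : ZMod 20} {c c' : ZMod p} (he : e.val % 2 = 1)
    (hf : f.val % 2 = 1) (hc : c ≠ 0)
    (hH : Rels0 ({(e, c), (10 - e, -c), (f, c'), (10 - f, -c')} : Multiset (ZMod 20 × ZMod p)))
    (hz1 : ((f, c') : ZMod 20 × ZMod p) ≠ -(e, c)) (hz2 : ((10 - f, -c') : ZMod 20 × ZMod p) ≠ -(e, c)) : False := by
  obtain ⟨hfe, hcc⟩ := two_odd_core hp h19 (rels0_halfpair he hf hH) rfl he hf hc hz1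
  apply hz2
  rw [hfe, hcc, Prod.neg_mk, Prod.mk.injEq]
  exact ⟨by ring, rfl⟩

/-! ### Level `20p`: arithmetic, the transfer to level `10p`, pair removal, the doubling map -/

/-- `10p` as a residue modulo `20p` (Shioda's `m′ = m/2`). -/
local notation "K20" => (((10 * p : ℕ)) : ZMod (20 * p))

/-- `10p + 10p = 0` in `ℤ/20p`. [folklore] -/
private theorem K_add_K : K20 + K20 = 0 := by
  have h : K20 + K20 = (((20 * p : ℕ)) : ZMod (20 * p)) := by push_cast; ring
  rw [h, ZMod.natCast_self]

/-- `2 · 10p = 0`. [folklore] -/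
private theorem two_mul_K : (2 : ZMod (20 * p)) * K20 = 0 := by rw [two_mul, K_add_K]

/-- `−10p = 10p`. [folklore] -/
private theorem neg_K : -K20 = K20 := by linear_combination -(K_add_K (p := p))

/-- `⟨10p⟩ = 10p`. [folklore] -/
private theorem val_K (hp : 0 < p) : (K20).val = 10 * p := by
  rw [ZMod.val_natCast, Nat.mod_eq_of_lt (by omega)]

/-- `10p ≠ 0`. [folklore] -/
private theorem K_ne_zero (hp : 0 < p) : K20 ≠ 0 := fun h ↦ by
  have := val_K hp; rw [h, ZMod.val_zero] at this; omega

/-- `⟨x + 10p⟩`: add `10p` and reduce. [folklore] -/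
private theorem val_add_K [NeZero (20 * p)] (hp : 0 < p) (x : ZMod (20 * p)) :
    ((x + K20).val = x.val + 10 * p ∧ x.val < 10 * p) ∨ ((x + K20).val + 20 * p = x.val + 10 * p ∧ 10 * p ≤ x.val) := by
  have hq := val_K hp
  have hx := ZMod.val_lt x
  by_cases h : x.val < 10 * p
  · left
    refine ⟨?_, h⟩
    rw [ZMod.val_add_of_lt (by rw [hq]; omega), hq]
  · right
    refine ⟨?_, by omega⟩
    have := ZMod.val_add_val_of_le (a := x) (b := K20) (by rw [hq]; omega)
    rw [hq] at this
    omega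

/-- `⟨2x⟩`: double and reduce. [folklore] -/
private theorem val_two_mul [NeZero (20 * p)] (hp : 0 < p) (x : ZMod (20 * p)) :
    (((2 : ZMod (20 * p)) * x).val = 2 * x.val ∧ x.val < 10 * p) ∨
      (((2 : ZMod (20 * p)) * x).val + 20 * p = 2 * x.val ∧ 10 * p ≤ x.val) := by
  have h2 : ((2 : ZMod (20 * p))).val = 2 := by
    rw [show (2 : ZMod (20 * p)) = ((2 : ℕ) : ZMod (20 * p)) by norm_cast, ZMod.val_natCast, Nat.mod_eq_of_lt (by omega)]
  have hx := ZMod.val_lt x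
  rw [ZMod.val_mul, h2]
  by_cases h : x.val < 10 * p
  · left
    exact ⟨Nat.mod_eq_of_lt (by omega), h⟩
  · right
    refine ⟨?_, by omega⟩
    rw [Nat.mod_eq_sub_mod (by omega), Nat.mod_eq_of_lt (by omega)]
    omega

/-- `10p · x = 10p` for odd `x`, `= 0` for even `x`. [folklore] -/
private theorem K_mul [NeZero (20 * p)] (x : ZMod (20 * p)) : K20 * x = if x.val % 2 = 1 then K20 else 0 := by
  have e : x = ((x.val : ℕ) : ZMod (20 * p)) := (ZMod.natCast_zmod_val x).symm
  have hd := Nat.div_add_mod x.val 2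
  have h2 := two_mul_K (p := p)
  push_cast at h2
  split_ifs with h
  · rw [h] at hd
    conv_lhs => rw [e, ← hd]
    push_cast
    linear_combination (↑(x.val / 2) : ZMod (20 * p)) * h2
  · have h0 : x.val % 2 = 0 := by omega
    rw [h0, add_zero] at hd
    conv_lhs => rw [e, ← hd]
    push_cast
    linear_combination (↑(x.val / 2) : ZMod (20 * p)) * h2

/-- A unit of `ℤ/20p` is odd. [folklore] -/
private theorem odd_of_isUnit {u : ZMod (20 * p)} (hu : IsUnit u) : u.val % 2 = 1 := by
  obtain ⟨u, rfl⟩ := hu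
  have hc := ZMod.val_coe_unit_coprime u
  by_contra h
  have h2 : 2 ∣ (u : ZMod (20 * p)).val := Nat.dvd_of_mod_eq_zero (by omega)
  have : 2 ∣ Nat.gcd (u : ZMod (20 * p)).val (20 * p) := Nat.dvd_gcd h2 ⟨10 * p, by omega⟩
  rw [hc] at this
  omega

/-- `1 + 10p` is a unit (an involution). [folklore] -/
private theorem isUnit_one_add_K : IsUnit (1 + K20 : ZMod (20 * p)) := by
  have hq2 : (K20 : ZMod (20 * p)) * K20 = 0 := by
    have : (K20 : ZMod (20 * p)) * K20 = ((5 * p : ℕ) : ZMod (20 * p)) * (((20 * p : ℕ)) : ZMod (20 * p)) := by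
      push_cast; ring
    rw [this, ZMod.natCast_self, mul_zero]
  have h1 : (1 + K20 : ZMod (20 * p)) * (1 + K20) = 1 := by linear_combination hq2 + two_mul_K (p := p)
  exact ⟨⟨1 + K20, 1 + K20, h1, h1⟩, rfl⟩

/-- Half the representative: `⟨w⟩/2` as a residue (used for even `w`). [folklore] -/
private def half (w : ZMod (20 * p)) : ZMod (20 * p) := ((w.val / 2 : ℕ) : ZMod (20 * p))

/-- `2 · (⟨w⟩/2) = w` for even `w`. [folklore] -/
private theorem two_mul_half [NeZero (20 * p)] {w : ZMod (20 * p)} (hw : w.val % 2 = 0) : (2 : ZMod (20 * p)) * half w = w := by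
  have h := Nat.div_add_mod w.val 2
  rw [hw, add_zero] at h
  have e : (((2 * (w.val / 2) : ℕ)) : ZMod (20 * p)) = w := by rw [h, ZMod.natCast_zmod_val]
  calc (2 : ZMod (20 * p)) * half w = (((2 * (w.val / 2) : ℕ)) : ZMod (20 * p)) := by unfold half; push_cast; ring
    _ = w := e

/-- `⟨w⟩/2 + ⟨w⟩/2 = w` for even `w`. [folklore] -/
private theorem half_add_half [NeZero (20 * p)] {w : ZMod (20 * p)} (hw : w.val % 2 = 0) : half w + half w = w := by
  rw [← two_mul, two_mul_half hw]

/-- The norm sum of a mapped multiset as a sum of representatives. [folklore] -/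
private theorem mNormSum_map {X : Type*} (t : Multiset X) {k : ℕ} (g : X → ZMod k) :
    mNormSum (t.map g) = (t.map fun w ↦ (g w).val).sum := by
  simp only [mNormSum, Multiset.map_map, Function.comp_def]

/-- The representative of the reduction modulo `10p`. [folklore] -/
private theorem val_castHom [NeZero (20 * p)] (hnm : 10 * p ∣ 20 * p) (y : ZMod (20 * p)) :
    (ZMod.castHom hnm (ZMod (10 * p)) y).val = y.val % (10 * p) := by
  rw [ZMod.castHom_apply, ZMod.cast_eq_val, ZMod.val_natCast]

/-- **`⟨y⟩ + ⟨y + 10p⟩ = 2⟨ȳ⟩ + 10p`** (`ȳ = y mod 10p`). [folklore] -/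
private theorem val_add_val_add_K [NeZero (20 * p)] (hp : 0 < p) (hnm : 10 * p ∣ 20 * p) (y : ZMod (20 * p)) :
    y.val + (y + K20).val = 2 * (ZMod.castHom hnm (ZMod (10 * p)) y).val + 10 * p := by
  rw [val_castHom]
  rcases val_add_K hp y with ⟨h, hlt⟩ | ⟨h, hle⟩
  · rw [Nat.mod_eq_of_lt hlt]; omega
  · rw [Nat.mod_eq_sub_mod hle, Nat.mod_eq_of_lt (by have := ZMod.val_lt y; omega)]; omega

/-- **`⟨2y⟩ = 2⟨ȳ⟩`**. [folklore] -/
private theorem val_two_mul_eq [NeZero (20 * p)] (hp : 0 < p) (hnm : 10 * p ∣ 20 * p) (y : ZMod (20 * p)) :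
    ((2 : ZMod (20 * p)) * y).val = 2 * (ZMod.castHom hnm (ZMod (10 * p)) y).val := by
  rw [val_castHom]
  rcases val_two_mul hp y with ⟨h, hlt⟩ | ⟨h, hle⟩
  · rw [Nat.mod_eq_of_lt hlt]; omega
  · rw [Nat.mod_eq_sub_mod hle, Nat.mod_eq_of_lt (by have := ZMod.val_lt y; omega)]; omega

/-- The reduction of an odd residue is non-zero. [folklore] -/
private theorem castHom_ne_zero_of_odd [NeZero (20 * p)] (hnm : 10 * p ∣ 20 * p) {w : ZMod (20 * p)} (hw : w.val % 2 = 1) :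
    ZMod.castHom hnm (ZMod (10 * p)) w ≠ 0 := by
  intro h
  have hv := congrArg ZMod.val h
  rw [val_castHom, ZMod.val_zero] at hv
  obtain ⟨k, hk⟩ := Nat.dvd_of_mod_eq_zero hv
  have : 2 ∣ w.val := ⟨5 * p * k, by rw [hk]; ring⟩
  omega

/-- The reduction of half a non-zero even residue is non-zero. [folklore] -/
private theorem castHom_half_ne_zero [NeZero (20 * p)] (hnm : 10 * p ∣ 20 * p) {w : ZMod (20 * p)} (hw0 : w ≠ 0)
    (hw : w.val % 2 = 0) : ZMod.castHom hnm (ZMod (10 * p)) (half w) ≠ 0 := by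
  intro h
  have hv := congrArg ZMod.val h
  rw [val_castHom, ZMod.val_zero, half, ZMod.val_natCast, Nat.mod_mod_of_dvd _ ⟨2, by ring⟩] at hv
  have hlt := ZMod.val_lt w
  have hdvd : 10 * p ∣ w.val / 2 := Nat.dvd_of_mod_eq_zero hv
  have h0' : w.val / 2 = 0 := Nat.eq_zero_of_dvd_of_lt hdvd (by omega)
  have h0 : w.val = 0 := by omega
  exact hw0 ((ZMod.val_eq_zero w).mp h0)

/-- The image of a unit under `unitsMap` is its reduction. [folklore] -/
private theorem coe_unitsMap (hnm : 10 * p ∣ 20 * p) (u : (ZMod (20 * p))ˣ) :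
    ((ZMod.unitsMap hnm u : (ZMod (10 * p))ˣ) : ZMod (10 * p)) = ZMod.castHom hnm (ZMod (10 * p)) (u : ZMod (20 * p)) := by
  simp [ZMod.unitsMap_def]

/-- **The transfer of a Hodge multiset of level `20p` is a Hodge multiset of level `10p`.** Split a multiset over `ℤ/20p` into
its odd part `s₁` and its even part `s₀`; then `T(s) = (s₁ mod 10p) + 2·((s₀/2) mod 10p)` (halve the even members, reduce
everything modulo `10p`, count the halved members twice) is a Hodge multiset over `ℤ/10p` whenever `s₁ + s₀` is one over `ℤ/20p`.
PROOF: for a unit `u` of `ℤ/20p` also `u(1 + 10p)` is a unit, and `u(1 + 10p)w = uw + 10p` for odd `w`, `= uw` for even `w`;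
adding the two norm equations and using `⟨y⟩ + ⟨y + 10p⟩ = 2⟨ȳ⟩ + 10p`, `⟨2y⟩ = 2⟨ȳ⟩` gives the norm equation of `T(s)` at `ū`;
every unit of `ℤ/10p` is such a `ū` (verbatim the argument of `isHodgeMultiset_transfer_twentyFourPrime`, the elementary shadow of
the distribution relation of the Bernoulli function). [cite: Aoki1983, Prop. 2.2] [cite: Shioda1979PJA, §1 eq. (2)] -/
theorem isHodgeMultiset_transfer_twentyPrime [NeZero (20 * p)] (hp : 0 < p) (hnm : 10 * p ∣ 20 * p)
    {so se : Multiset (ZMod (20 * p))} (hso : ∀ w ∈ so, w.val % 2 = 1) (hse : ∀ w ∈ se, w.val % 2 = 0)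
    (hs : IsHodgeMultiset (so + se)) :
    IsHodgeMultiset (so.map (ZMod.castHom hnm (ZMod (10 * p))) +
      (se.map fun w ↦ ZMod.castHom hnm (ZMod (10 * p)) (half w)) + se.map fun w ↦ ZMod.castHom hnm (ZMod (10 * p)) (half w)) := by
  classical
  set R := ZMod.castHom hnm (ZMod (10 * p)) with hR
  obtain ⟨⟨hne, hsum⟩, hnorm⟩ := hs
  refine ⟨⟨?_, ?_⟩, fun v ↦ ?_⟩
  · intro a ha
    rcases Multiset.mem_add.mp ha with ha | ha
    · rcases Multiset.mem_add.mp ha with ha | ha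
      · obtain ⟨w, hw, rfl⟩ := Multiset.mem_map.mp ha
        exact castHom_ne_zero_of_odd hnm (hso w hw)
      · obtain ⟨w, hw, rfl⟩ := Multiset.mem_map.mp ha
        exact castHom_half_ne_zero hnm (hne w (Multiset.mem_add.mpr (Or.inr hw))) (hse w hw)
    · obtain ⟨w, hw, rfl⟩ := Multiset.mem_map.mp ha
      exact castHom_half_ne_zero hnm (hne w (Multiset.mem_add.mpr (Or.inr hw))) (hse w hw)
  · have h1 : (so.map R).sum = R so.sum := (map_multiset_sum R so).symm
    have h2 : (se.map fun w ↦ R (half w)).sum + (se.map fun w ↦ R (half w)).sum = R se.sum := by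
      rw [← Multiset.sum_map_add, map_multiset_sum]
      congr 1
      refine Multiset.map_congr rfl fun w hw ↦ ?_
      rw [← RingHom.map_add, half_add_half (hse w hw)]
    rw [Multiset.sum_add, Multiset.sum_add, add_assoc, h1, h2, ← RingHom.map_add, ← Multiset.sum_add, hsum, RingHom.map_zero]
  · obtain ⟨u, hu⟩ := ZMod.unitsMap_surjective hnm v
    have hvu : (v : ZMod (10 * p)) = R u := by rw [← hu, coe_unitsMap]
    obtain ⟨w1, hw1⟩ := isUnit_one_add_K (p := p)
    have odd_u : (u : ZMod (20 * p)).val % 2 = 1 := odd_of_isUnit u.isUnit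
    have hqu : K20 * (u : ZMod (20 * p)) = K20 := by rw [K_mul, if_pos odd_u]
    have h1 := hnorm u
    have h2 := hnorm (u * w1)
    rw [Multiset.map_add, mNormSum_add, mNormSum_map, mNormSum_map, Multiset.card_add] at h1 h2
    have eso : (so.map fun w ↦ (((u * w1 : (ZMod (20 * p))ˣ) : ZMod (20 * p)) * w).val) =
        so.map fun w ↦ ((u : ZMod (20 * p)) * w + K20).val := by
      refine Multiset.map_congr rfl fun w hw ↦ ?_
      have hqw : K20 * w = K20 := by rw [K_mul, if_pos (hso w hw)]
      rw [Units.val_mul, hw1]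
      congr 1
      linear_combination (u : ZMod (20 * p)) * hqw + hqu
    have ese : (se.map fun w ↦ (((u * w1 : (ZMod (20 * p))ˣ) : ZMod (20 * p)) * w).val) =
        se.map fun w ↦ ((u : ZMod (20 * p)) * w).val := by
      refine Multiset.map_congr rfl fun w hw ↦ ?_
      have hqw : K20 * w = 0 := by rw [K_mul, if_neg (by rw [hse w hw]; omega)]
      rw [Units.val_mul, hw1]
      congr 1
      linear_combination (u : ZMod (20 * p)) * hqw
    rw [eso, ese] at h2
    have hO : (so.map fun w ↦ ((u : ZMod (20 * p)) * w).val).sum + (so.map fun w ↦ ((u : ZMod (20 * p)) * w + K20).val).sum =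
        2 * (so.map fun w ↦ (R ((u : ZMod (20 * p)) * w)).val).sum + 10 * p * Multiset.card so := by
      rw [← Multiset.sum_map_add]
      have : (so.map fun w ↦ ((u : ZMod (20 * p)) * w).val + ((u : ZMod (20 * p)) * w + K20).val) =
          so.map fun w ↦ 2 * (R ((u : ZMod (20 * p)) * w)).val + 10 * p :=
        Multiset.map_congr rfl fun w _ ↦ val_add_val_add_K hp hnm _
      rw [this, Multiset.sum_map_add, Multiset.sum_map_mul_left, Multiset.map_const', Multiset.sum_replicate, smul_eq_mul,
        mul_comm (Multiset.card so)]
    have hE : (se.map fun w ↦ ((u : ZMod (20 * p)) * w).val).sum =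
        2 * (se.map fun w ↦ (R ((u : ZMod (20 * p)) * half w)).val).sum := by
      rw [← Multiset.sum_map_mul_left]
      congr 1
      refine Multiset.map_congr rfl fun w hw ↦ ?_
      rw [← val_two_mul_eq hp hnm, mul_left_comm, two_mul_half (hse w hw)]
    simp only [Multiset.map_add, mNormSum_add, Multiset.map_map, mNormSum_map, Multiset.card_add, Multiset.card_map,
      Function.comp_apply]
    have tso : (so.map fun w ↦ ((v : ZMod (10 * p)) * R w).val) = so.map fun w ↦ (R ((u : ZMod (20 * p)) * w)).val := by
      refine Multiset.map_congr rfl fun w _ ↦ ?_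
      rw [hvu, ← map_mul]
    have tse : (se.map fun w ↦ ((v : ZMod (10 * p)) * R (half w)).val) =
        se.map fun w ↦ (R ((u : ZMod (20 * p)) * half w)).val := by
      refine Multiset.map_congr rfl fun w _ ↦ ?_
      rw [hvu, ← map_mul]
    rw [tso, tse]
    generalize Multiset.card so = cso at h1 h2 hO ⊢
    generalize Multiset.card se = cse at h1 h2 ⊢
    have hmn : 20 * p * (cso + cse) = 2 * (10 * p * cso) + 2 * (10 * p * cse) := by ring
    have hgoal : 10 * p * (cso + cse + cse) = 10 * p * cso + 2 * (10 * p * cse) := by ring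
    rw [hgoal]
    omega

/-- **Pair removal.** A Hodge multiset minus a pair `{a, −a}` is a Hodge multiset (the norm of a pair is the level at every
unit). [cite: Shioda1979PJA, §1 (elements of length 1)] -/
private theorem isHodgeMultiset_of_cons_cons_neg {n : ℕ} [NeZero n] {a : ZMod n} {τ : Multiset (ZMod n)}
    (h : IsHodgeMultiset (a ::ₘ (-a) ::ₘ τ)) : IsHodgeMultiset τ := by
  obtain ⟨⟨hne, hsum⟩, hnorm⟩ := h
  have ha : a ≠ 0 := hne a (Multiset.mem_cons_self _ _)
  refine ⟨⟨fun x hx ↦ hne x (Multiset.mem_cons_of_mem (Multiset.mem_cons_of_mem hx)), ?_⟩, fun t ↦ ?_⟩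
  · simpa [Multiset.sum_cons] using hsum
  · have h := hnorm t
    simp only [Multiset.map_cons, mNormSum_cons, Multiset.card_cons] at h
    have hta : ((t : ZMod n) * a) ≠ 0 := (t.isUnit.mul_right_eq_zero).not.mpr ha
    have hneg : ((t : ZMod n) * -a).val = n - ((t : ZMod n) * a).val := by
      rw [mul_neg, ZMod.neg_val, if_neg hta]
    have hlt := ZMod.val_lt ((t : ZMod n) * a)
    rw [hneg] at h
    have e : n * (Multiset.card τ + 1 + 1) = n * Multiset.card τ + 2 * n := by ring
    rw [e] at h
    omega

/-- **A Hodge pair sums to zero** (the congruence part of the definition). [folklore] -/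
private theorem eq_neg_of_isHodgeMultiset_pair {n : ℕ} {a b : ZMod n} (h : IsHodgeMultiset ({a, b} : Multiset (ZMod n))) :
    b = -a := by
  have := h.1.2
  simp only [Multiset.insert_eq_cons, Multiset.sum_cons, Multiset.sum_singleton] at this
  linear_combination this

/-- **Halving the multiplicities keeps the norm equations** (`T(s) = σ + σ`). [folklore] -/
private theorem norm_of_add_self {n : ℕ} {σ : Multiset (ZMod n)} (h : IsHodgeMultiset (σ + σ)) (t : (ZMod n)ˣ) :
    2 * mNormSum (σ.map fun a ↦ (t : ZMod n) * a) = n * Multiset.card σ := by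
  have := h.2 t
  rw [Multiset.map_add, mNormSum_add, Multiset.card_add,
    show n * (Multiset.card σ + Multiset.card σ) = 2 * (n * Multiset.card σ) by ring] at this
  omega

/-- `5p` as a residue modulo `10p` (Shioda's `m′` of the level `10p`). -/
local notation "K10" => (((5 * p : ℕ)) : ZMod (10 * p))

section Double

/-- The doubling map `t ↦ 2t` from `ℤ/10p` to `ℤ/20p` (on representatives). [folklore] -/
private def dbl (t : ZMod (10 * p)) : ZMod (20 * p) := ((2 * t.val : ℕ) : ZMod (20 * p))

/-- `dbl` is additive. [folklore] -/
private theorem dbl_add [NeZero (10 * p)] (a b : ZMod (10 * p)) : dbl (a + b) = dbl a + dbl b := by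
  have key : ∃ k : ℕ, 2 * a.val + 2 * b.val = 2 * (a + b).val + 20 * p * k := by
    by_cases h : a.val + b.val < 10 * p
    · exact ⟨0, by rw [ZMod.val_add_of_lt h]; ring⟩
    · refine ⟨1, ?_⟩
      have e := ZMod.val_add_val_of_le (not_lt.mp h)
      omega
  obtain ⟨k, hk⟩ := key
  have := congrArg (Nat.cast : ℕ → ZMod (20 * p)) hk
  rw [Nat.cast_add, Nat.cast_add, Nat.cast_mul ((20 * p : ℕ)), ZMod.natCast_self, zero_mul, add_zero] at this
  unfold dbl
  rw [this]

/-- `dbl 0 = 0`. [folklore] -/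
private theorem dbl_zero : dbl (0 : ZMod (10 * p)) = 0 := by
  simp [dbl]

/-- `dbl (−a) = −dbl a`. [folklore] -/
private theorem dbl_neg [NeZero (10 * p)] (a : ZMod (10 * p)) : dbl (-a) = -dbl a :=
  eq_neg_of_add_eq_zero_left (by rw [← dbl_add, neg_add_cancel, dbl_zero])

/-- `dbl (k a) = k dbl a`. [folklore] -/
private theorem dbl_natCast_mul [NeZero (10 * p)] (k : ℕ) (a : ZMod (10 * p)) :
    dbl ((k : ZMod (10 * p)) * a) = (k : ZMod (20 * p)) * dbl a := by
  induction k with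
  | zero => simp [dbl_zero]
  | succ k ih => rw [Nat.cast_succ, Nat.cast_succ, add_mul, one_mul, dbl_add, ih, add_mul, one_mul]

/-- `dbl (2a) = 2 dbl a`. [folklore] -/
private theorem dbl_two_mul [NeZero (10 * p)] (a : ZMod (10 * p)) : dbl (2 * a) = 2 * dbl a := by
  exact_mod_cast dbl_natCast_mul 2 a

/-- `dbl (4a) = 4 dbl a`. [folklore] -/
private theorem dbl_four_mul [NeZero (10 * p)] (a : ZMod (10 * p)) : dbl (4 * a) = 4 * dbl a := by
  exact_mod_cast dbl_natCast_mul 4 a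

/-- `dbl (y mod 10p) = 2y`. [folklore] -/
private theorem dbl_castHom [NeZero (20 * p)] (hnm : 10 * p ∣ 20 * p) (y : ZMod (20 * p)) :
    dbl (ZMod.castHom hnm (ZMod (10 * p)) y) = 2 * y := by
  unfold dbl
  rw [val_castHom]
  have key : ∃ k : ℕ, 2 * y.val = 2 * (y.val % (10 * p)) + 20 * p * k := by
    have hlt := ZMod.val_lt y
    by_cases h : y.val < 10 * p
    · exact ⟨0, by rw [Nat.mod_eq_of_lt h]; ring⟩
    · refine ⟨1, ?_⟩
      rw [Nat.mod_eq_sub_mod (not_lt.mp h), Nat.mod_eq_of_lt (by omega)]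
      omega
  obtain ⟨k, hk⟩ := key
  have := congrArg (Nat.cast : ℕ → ZMod (20 * p)) hk
  rw [Nat.cast_add, Nat.cast_mul ((20 * p : ℕ)), ZMod.natCast_self, zero_mul, add_zero, Nat.cast_mul, Nat.cast_ofNat,
    ZMod.natCast_zmod_val] at this
  rw [← this]

/-- `dbl ((w/2) mod 10p) = w` for even `w`. [folklore] -/
private theorem dbl_castHom_half [NeZero (20 * p)] (hnm : 10 * p ∣ 20 * p) {w : ZMod (20 * p)} (hw : w.val % 2 = 0) :
    dbl (ZMod.castHom hnm (ZMod (10 * p)) (half w)) = w := by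
  rw [dbl_castHom hnm, two_mul_half hw]

/-- `⟨5p̄⟩ = 5p` at level `10p`. [folklore] -/
private theorem val_K10 (hp : 0 < p) : (K10).val = 5 * p := by
  rw [ZMod.val_natCast, Nat.mod_eq_of_lt (by omega)]

/-- `dbl 5p̄ = 10p`. [folklore] -/
private theorem dbl_K10 (hp : 0 < p) : dbl K10 = K20 := by
  unfold dbl
  rw [val_K10 hp, show 2 * (5 * p) = 10 * p by ring]

/-- `5p̄ ≠ 0` at level `10p`. [folklore] -/
private theorem K10_ne_zero (hp : 0 < p) : K10 ≠ 0 := fun h ↦ by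
  have h1 := congrArg ZMod.val h
  rw [val_K10 hp, ZMod.val_zero] at h1
  omega

/-- `−5p̄ = 5p̄` at level `10p`. [folklore] -/
private theorem neg_K10 : -K10 = K10 := by
  have h : K10 + K10 = (((10 * p : ℕ)) : ZMod (10 * p)) := by push_cast; ring
  rw [ZMod.natCast_self] at h
  linear_combination -h

/-- `2z = 0` iff `z ∈ {0, 5p̄}` at level `10p`. [folklore] -/
private theorem two_mul_eq_zero_tenP [NeZero (10 * p)] (hp : 0 < p) {z : ZMod (10 * p)} :
    (2 : ZMod (10 * p)) * z = 0 ↔ z = 0 ∨ z = K10 := by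
  constructor
  · intro h
    have hv := congrArg ZMod.val h
    have h2 : ((2 : ZMod (10 * p))).val = 2 := by
      rw [show (2 : ZMod (10 * p)) = ((2 : ℕ) : ZMod (10 * p)) by norm_cast, ZMod.val_natCast, Nat.mod_eq_of_lt (by omega)]
    rw [ZMod.val_mul, h2, ZMod.val_zero] at hv
    have hlt := ZMod.val_lt z
    obtain ⟨k, hk⟩ := Nat.dvd_of_mod_eq_zero hv
    have hk2 : k < 2 := by
      by_contra hk2
      have : 10 * p * 2 ≤ 10 * p * k := Nat.mul_le_mul_left _ (by omega)
      omega
    interval_cases k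
    · left
      apply ZMod.val_injective (10 * p)
      rw [ZMod.val_zero]; omega
    · right
      apply ZMod.val_injective (10 * p)
      rw [val_K10 hp]; omega
  · rintro (rfl | rfl)
    · rw [mul_zero]
    · linear_combination -(neg_K10 (p := p))

/-- The residue of the norm sum is the sum. [folklore] -/
private theorem natCast_mNormSum {n : ℕ} [NeZero n] (t : Multiset (ZMod n)) : ((mNormSum t : ℕ) : ZMod n) = t.sum := by
  rw [mNormSum, Nat.cast_multiset_sum, Multiset.map_map]
  have : (t.map (Nat.cast ∘ ZMod.val) : Multiset (ZMod n)) = t.map id :=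
    Multiset.map_congr rfl fun a _ ↦ ZMod.natCast_zmod_val a
  rw [this, Multiset.map_id]

/-- Parity at level `10p`: the reduction keeps the parity of the representative. [folklore] -/
private theorem val_castHom_mod_two [NeZero (20 * p)] (hnm : 10 * p ∣ 20 * p) (y : ZMod (20 * p)) :
    (ZMod.castHom hnm (ZMod (10 * p)) y).val % 2 = y.val % 2 := by
  rw [val_castHom, Nat.mod_mod_of_dvd _ (⟨5 * p, by ring⟩ : 2 ∣ 10 * p)]

/-- Parity at level `10p`: negation keeps parity. [folklore] -/
private theorem val_neg_mod_two_ten [NeZero (10 * p)] (a : ZMod (10 * p)) : (-a).val % 2 = a.val % 2 := by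
  rw [ZMod.neg_val]
  split_ifs with h
  · rw [h, ZMod.val_zero]
  · have := ZMod.val_lt a
    omega

/-- Parity at level `10p`: a `2`-multiple is even. [folklore] -/
private theorem val_two_mul_mod_two_ten [NeZero (10 * p)] (a : ZMod (10 * p)) : ((2 : ZMod (10 * p)) * a).val % 2 = 0 := by
  have h2 : ((2 : ZMod (10 * p))).val % 2 = 0 := by
    rw [show (2 : ZMod (10 * p)) = ((2 : ℕ) : ZMod (10 * p)) by norm_cast, ZMod.val_natCast]
    rcases Nat.lt_or_ge 2 (10 * p) with h | h
    · rw [Nat.mod_eq_of_lt h]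
    · have : 10 * p = 0 ∨ 10 * p = 1 ∨ 10 * p = 2 := by omega
      rcases this with h0 | h0 | h0
      · exact absurd h0 (NeZero.ne _)
      · omega
      · rw [h0]
  rw [ZMod.val_mul, Nat.mod_mod_of_dvd _ ⟨5 * p, by ring⟩, Nat.mul_mod, h2, zero_mul, Nat.zero_mod]

end Double

/-! ### Indices: pair-freeness of explicit quadruples -/

/-- Two distinct positions of a tuple give a member of the value multiset and a member of its erasure. [folklore] -/
private theorem apply_mem_erase_of_ne {K : ℕ} {X : Type*} [DecidableEq X] (Z : Fin K → X) {i j : Fin K} (hij : i ≠ j) :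
    Z j ∈ (univ.val.map Z).erase (Z i) := by
  by_cases h : Z j = Z i
  · rw [h, ← Multiset.count_pos, Multiset.count_erase_self]
    have h2 : 2 ≤ count (Z i) (univ.val.map Z) := by
      rw [Multiset.count_map]
      have hsub : ({i, j} : Finset (Fin K)).val ≤ univ.val.filter fun k ↦ Z i = Z k := by
        rw [Multiset.le_iff_subset (Finset.nodup _)]
        intro k hk
        rw [Finset.mem_val, Finset.mem_insert, Finset.mem_singleton] at hk
        rw [Multiset.mem_filter]
        rcases hk with rfl | rfl
        · exact ⟨Finset.mem_univ_val _, rfl⟩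
        · exact ⟨Finset.mem_univ_val _, h.symm⟩
      calc 2 = Multiset.card ({i, j} : Finset (Fin K)).val := by rw [Finset.card_val, Finset.card_pair hij]
        _ ≤ _ := Multiset.card_le_card hsub
    omega
  · exact (Multiset.mem_erase_of_ne h).mpr (Multiset.mem_map.mpr ⟨j, Finset.mem_univ_val j, rfl⟩)

/-- Indecomposability of a tuple in terms of its multiset of values. [folklore] -/
private theorem pairfree_of_fun {n : ℕ} {α : Fin 4 → ZMod n} (hind : ∀ i j : Fin 4, i ≠ j → α i + α j ≠ 0) :
    ∀ a ∈ univ.val.map α, ∀ b ∈ (univ.val.map α).erase a, a + b ≠ 0 := by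
  classical
  intro a ha b hb hab
  obtain ⟨i, -, rfl⟩ := Multiset.mem_map.mp ha
  by_cases hba : b = α i
  · have h2 : 2 ≤ count (α i) (univ.val.map α) := by
      have := Multiset.count_pos.mpr (hba ▸ hb)
      rw [Multiset.count_erase_self] at this
      omega
    rw [count_univ_val_map] at h2
    obtain ⟨j, hj, k, hk, hjk⟩ := Finset.one_lt_card.mp h2
    simp only [Finset.mem_filter, Finset.mem_univ, true_and] at hj hk
    exact hind j k hjk (by rw [hj, hk, ← hba]; nth_rw 1 [hba]; exact hab)
  · have hb' : b ∈ univ.val.map α := Multiset.mem_of_mem_erase hb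
    obtain ⟨j, -, rfl⟩ := Multiset.mem_map.mp hb'
    exact hind i j (fun e ↦ hba (by rw [e])) hab

/-- The value multiset of `![a, b, c, d]`. [folklore] -/
private theorem univ_val_map_four {X : Type*} (a b c d : X) : univ.val.map ![a, b, c, d] = {a, b, c, d} := by
  simp; rfl

/-- **Parity count.** A multiset over `ℤ/20p` with sum `0` has an even number of odd entries. [folklore] -/
private theorem even_card_filter_odd [NeZero (20 * p)] {s : Multiset (ZMod (20 * p))} (hs : s.sum = 0) :
    Even (Multiset.card (s.filter fun a ↦ a.val % 2 = 1)) := by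
  have hsum : 20 * p ∣ (s.map ZMod.val).sum := by
    rw [← ZMod.natCast_eq_zero_iff, Nat.cast_multiset_sum, Multiset.map_map]
    have : (s.map (Nat.cast ∘ ZMod.val) : Multiset (ZMod (20 * p))) = s.map id :=
      Multiset.map_congr rfl fun a _ ↦ ZMod.natCast_zmod_val a
    rw [this, Multiset.map_id, hs]
  have h2 : 2 ∣ (s.map ZMod.val).sum := Nat.dvd_trans ⟨10 * p, by ring⟩ hsum
  have key : ∀ t : Multiset (ZMod (20 * p)),
      (t.map ZMod.val).sum % 2 = Multiset.card (t.filter fun a ↦ a.val % 2 = 1) % 2 := by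
    intro t
    induction t using Multiset.induction_on with
    | empty => simp
    | cons a t ih =>
      rw [Multiset.map_cons, Multiset.sum_cons, Multiset.filter_cons, Multiset.card_add, Nat.add_mod, ih]
      split_ifs with ha
      · rw [Multiset.card_singleton]
        omega
      · rw [Multiset.card_zero]
        omega
  have := key s
  rw [Nat.even_iff]
  omega

/-! ### Small multiset and coordinate helpers -/

/-- `{a, b} + {c, d} = {a, b, c, d}`. [folklore] -/
private theorem pair_add_pair {X : Type*} (a b c d : X) : ({a, b} : Multiset X) + {c, d} = {a, b, c, d} := by
  simp only [Multiset.insert_eq_cons, Multiset.cons_add, Multiset.singleton_add]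

/-- A `4`-multiset whose six pairwise sums are non-zero is pair-free. [folklore] -/
private theorem pairfree_quad {n : ℕ} {a b c d : ZMod n} (hab : a + b ≠ 0) (hac : a + c ≠ 0) (had : a + d ≠ 0)
    (hbc : b + c ≠ 0) (hbd : b + d ≠ 0) (hcd : c + d ≠ 0) :
    ∀ u ∈ ({a, b, c, d} : Multiset (ZMod n)), ∀ v ∈ (({a, b, c, d} : Multiset (ZMod n))).erase u, u + v ≠ 0 := by
  rw [← univ_val_map_four]
  refine pairfree_of_fun fun i j hij h ↦ ?_
  fin_cases i <;> fin_cases j <;> simp at hij h <;>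
    first
    | exact hab (by linear_combination h)
    | exact hac (by linear_combination h)
    | exact had (by linear_combination h)
    | exact hbc (by linear_combination h)
    | exact hbd (by linear_combination h)
    | exact hcd (by linear_combination h)

/-- The kernel of the reduction `ℤ/20p → ℤ/10p` is `{0, 10p}`. [folklore] -/
private theorem castHom_eq_zero_iff [NeZero (20 * p)] (hp : 0 < p) (hnm : 10 * p ∣ 20 * p) {w : ZMod (20 * p)} :
    ZMod.castHom hnm (ZMod (10 * p)) w = 0 ↔ w = 0 ∨ w = K20 := by
  haveI : NeZero (10 * p) := ⟨by omega⟩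
  constructor
  · intro h0
    have hv := congrArg ZMod.val h0
    rw [val_castHom, ZMod.val_zero] at hv
    have hlt := ZMod.val_lt w
    obtain ⟨k, hk⟩ := Nat.dvd_of_mod_eq_zero hv
    have hk2 : k < 2 := by
      by_contra hk2
      have : 10 * p * 2 ≤ 10 * p * k := Nat.mul_le_mul_left _ (by omega)
      omega
    interval_cases k
    · left
      apply ZMod.val_injective (20 * p)
      rw [ZMod.val_zero]; omega
    · right
      apply ZMod.val_injective (20 * p)
      rw [val_K hp]; omega
  · rintro (rfl | rfl)
    · exact _root_.map_zero _
    · rw [map_natCast, show ((10 * p : ℕ) : ZMod (10 * p)) = 0 from ZMod.natCast_self _]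

/-- Two residues with the same reduction mod `10p` differ by `0` or `10p`. [folklore] -/
private theorem lift_eq [NeZero (20 * p)] (hp : 0 < p) (hnm : 10 * p ∣ 20 * p) {a b : ZMod (20 * p)}
    (h : ZMod.castHom hnm (ZMod (10 * p)) a = ZMod.castHom hnm (ZMod (10 * p)) b) : a = b ∨ a = b + K20 := by
  have : ZMod.castHom hnm (ZMod (10 * p)) (a - b) = 0 := by rw [_root_.map_sub, h, sub_self]
  rcases (castHom_eq_zero_iff hp hnm).mp this with e | e
  · left; linear_combination e
  · right; linear_combination e

/-! ### Case I: no odd member — the doubled standard elements of level `10p` -/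

/-- **All members even:** `T(s) = 2·σ` with `σ` a pair-free Hodge `4`-multiset of level `10p`, which the level-`10p` theorem
classifies (`p ≥ 19`); doubling back, `s = {x, x + 10p, −2x, 10p}` or `{x, x + 10p, 2x + 10p, −4x}` with `x = 2y`.
[cite: Shioda1982PicardFermat, §2 p. 726 (𝔍²ₘ(d) ≅ 𝔍²_{m/d}(1)) and Prop. 4 (Q′) p. 729] -/
private theorem case_all_even [NeZero (20 * p)] (hp : p.Prime) (h19 : 19 ≤ p) {s : Multiset (ZMod (20 * p))}
    (hs : IsHodgeMultiset s) (hcard : Multiset.card s = 4) (hpf : ∀ a ∈ s, ∀ b ∈ s.erase a, a + b ≠ 0)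
    (hev : ∀ w ∈ s, w.val % 2 = 0) :
    ∃ x : ZMod (20 * p), s = {x, x + K20, -(2 * x), K20} ∨ s = {x, x + K20, 2 * x + K20, -(4 * x)} := by
  classical
  have hp0 := hp.pos
  haveI : NeZero (10 * p) := ⟨by omega⟩
  have hnm : 10 * p ∣ 20 * p := ⟨2, by ring⟩
  set R := ZMod.castHom hnm (ZMod (10 * p)) with hR
  -- enumerate `s`
  obtain ⟨z1, hz1⟩ := Multiset.card_pos_iff_exists_mem.mp (by omega : 0 < Multiset.card s)
  have hct : Multiset.card (s.erase z1) = 3 := by rw [Multiset.card_erase_of_mem hz1, hcard]; rfl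
  obtain ⟨z2, z3, z4, ht⟩ := Multiset.card_eq_three.mp hct
  have hsZ : s = {z1, z2, z3, z4} := by rw [← Multiset.cons_erase hz1, ht]; rfl
  set Z : Fin 4 → ZMod (20 * p) := ![z1, z2, z3, z4] with hZ
  have hZs : univ.val.map Z = s := by rw [hsZ, hZ, univ_val_map_four]
  have hZev : ∀ i, (Z i).val % 2 = 0 := fun i ↦ hev _ (by rw [← hZs]; exact Multiset.mem_map.mpr ⟨i, Finset.mem_univ_val i, rfl⟩)
  -- the transfer `T(s) = σ + σ`
  have hT := isHodgeMultiset_transfer_twentyPrime hp0 hnm (so := 0) (se := s) (by simp) hev (by simpa using hs)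
  rw [Multiset.map_zero, zero_add] at hT
  set σ := s.map fun w ↦ R (half w) with hσ
  have hc4 : Multiset.card σ = 4 := by rw [hσ, Multiset.card_map, hcard]
  have hσH : IsHodgeMultiset σ := by
    have hnorm' := norm_of_add_self hT
    refine ⟨⟨fun a ha ↦ hT.1.1 a (Multiset.mem_add.mpr (Or.inl ha)), ?_⟩, hnorm'⟩
    have h1 := hnorm' 1
    simp only [Units.val_one, one_mul, Multiset.map_id', hc4] at h1
    have hN : mNormSum σ = 2 * (10 * p) := by omega
    have := natCast_mNormSum σ
    rw [hN, show ((2 * (10 * p) : ℕ) : ZMod (10 * p)) = 2 * ((10 * p : ℕ) : ZMod (10 * p)) by push_cast; ring,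
      ZMod.natCast_self, mul_zero] at this
    exact this.symm
  -- `σ` is pair-free (double back)
  set β : Fin 4 → ZMod (10 * p) := fun i ↦ R (half (Z i)) with hβ
  have hβσ : univ.val.map β = σ := by rw [hσ, ← hZs, Multiset.map_map]; rfl
  have hβind : ∀ i j : Fin 4, i ≠ j → β i + β j ≠ 0 := by
    intro i j hij h
    have h' := congrArg dbl h
    rw [dbl_add, dbl_zero, hβ] at h'
    simp only at h'
    rw [dbl_castHom_half hnm (hZev i), dbl_castHom_half hnm (hZev j)] at h'
    exact hpf (Z i) (by rw [← hZs]; exact Multiset.mem_map.mpr ⟨i, Finset.mem_univ_val i, rfl⟩) (Z j)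
      (hZs ▸ apply_mem_erase_of_ne Z hij) h'
  have hσpf : ∀ a ∈ σ, ∀ b ∈ σ.erase a, a + b ≠ 0 := by rw [← hβσ]; exact pairfree_of_fun hβind
  -- the classification at level `10p`
  obtain ⟨y, hy⟩ := classify_hodgeMultiset_tenPrime hp h19 hσH hc4 hσpf
  -- `s = σ.map dbl`
  have hsd : s = σ.map dbl := by
    rw [hσ, Multiset.map_map]
    conv_lhs => rw [← Multiset.map_id s]
    refine Multiset.map_congr rfl fun w hw ↦ ?_
    simp only [Function.comp_apply, id]
    rw [dbl_castHom_half hnm (hev w hw)]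
  rcases hy with e | e
  · refine ⟨dbl y, Or.inl ?_⟩
    rw [hsd, e]
    simp only [Multiset.insert_eq_cons, Multiset.map_cons, Multiset.map_singleton, dbl_add, dbl_neg, dbl_two_mul, dbl_K10 hp0]
  · refine ⟨dbl y, Or.inr ?_⟩
    rw [hsd, e]
    simp only [Multiset.insert_eq_cons, Multiset.map_cons, Multiset.map_singleton, dbl_add, dbl_neg, dbl_two_mul,
      dbl_four_mul, dbl_K10 hp0]

/-! ### Two odd members in the fibre `0`: the norm equations at the units `pt(1, λ)` -/

/-- For a prime `p ≥ 11`, an even `n ≤ 20` divisible by `p` is `0`. [folklore] -/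
private theorem eq_zero_of_dvd_of_even (hp : p.Prime) (h11 : 11 ≤ p) {n : ℕ} (hn : n ≤ 20) (he : n % 2 = 0) (hd : p ∣ n) :
    n = 0 := by
  obtain ⟨k, rfl⟩ := hd
  have hp2 : p % 2 = 1 := Nat.odd_iff.mp (hp.odd_of_ne_two (by omega))
  rcases Nat.lt_or_ge k 2 with hk | hk
  · interval_cases k
    · rfl
    · rw [mul_one] at he; omega
  · have : p * 2 ≤ p * k := Nat.mul_le_mul_left _ hk
    omega

/-- **The step-function contradiction.** If for every `μ ≠ 0` in `ℤ/p` there are `A, B < p` with `20A + F ≡ μ`,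
`20B + F′ ≡ −μ` and `A + B` independent of `μ` — where `F, F′ < 20` are even with `F + F′ ∉ {0, 20}` — then `p ≤ 7`:
`B` is an affine function of `A` modulo `p`, so `A + B` jumps by `p` inside `[0, p)` unless the jump is hidden at the at most
one excluded value of `A`, which the parity of `F, F′` forbids for `p ≥ 11`. [folklore] -/
private theorem step_contra (hp : p.Prime) (h11 : 11 ≤ p) (h20 : ((20 : ℕ) : ZMod p) ≠ 0) {F F' N : ℕ} (hF : F < 20)
    (hF' : F' < 20) (hFe : F % 2 = 0) (hF'e : F' % 2 = 0) (hS0 : F + F' ≠ 0) (hS20 : F + F' ≠ 20)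
    (H : ∀ μ : ZMod p, μ ≠ 0 → ∃ A B : ℕ, A < p ∧ B < p ∧ ((20 * A + F : ℕ) : ZMod p) = μ ∧
      ((20 * B + F' : ℕ) : ZMod p) = -μ ∧ A + B = N) : False := by
  haveI := Fact.mk hp
  have hp2 : p % 2 = 1 := Nat.odd_iff.mp (hp.odd_of_ne_two (by omega))
  -- the value of `A` at `μ = 20a + F` is `a`
  have HA : ∀ a : ℕ, a < p → ((20 * a + F : ℕ) : ZMod p) ≠ 0 →
      ∃ B : ℕ, B < p ∧ ((20 * B + F' : ℕ) : ZMod p) = -((20 * a + F : ℕ) : ZMod p) ∧ a + B = N := by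
    intro a ha hμ
    obtain ⟨A, B, hA, hB, eA, eB, hN⟩ := H _ hμ
    have eAa : A = a := by
      have e1 : ((20 : ℕ) : ZMod p) * (A : ZMod p) = ((20 : ℕ) : ZMod p) * (a : ZMod p) := by
        have := eA; push_cast at this ⊢; linear_combination this
      have e2 : (A : ZMod p) = (a : ZMod p) := mul_left_cancel₀ h20 e1
      rw [ZMod.natCast_eq_natCast_iff'] at e2
      rw [Nat.mod_eq_of_lt hA, Nat.mod_eq_of_lt ha] at e2
      exact e2
    subst eAa
    exact ⟨B, hB, eB, hN⟩
  -- admissibility of `a = 0` and `a = p − 1`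
  by_cases h0 : ((20 * 0 + F : ℕ) : ZMod p) = 0
  · -- `F ≡ 0`: then `F = 0`; use `a = 1` and `a = p − 1`
    have hF0 : F = 0 := by
      rw [ZMod.natCast_eq_zero_iff] at h0
      exact eq_zero_of_dvd_of_even hp h11 (by omega) (by omega) (by simpa using h0)
    subst hF0
    have h1ne : ((20 * 1 + 0 : ℕ) : ZMod p) ≠ 0 := by simpa using h20
    have hpne : ((20 * (p - 1) + 0 : ℕ) : ZMod p) ≠ 0 := by
      intro h
      have e : ((20 * (p - 1) + 0 : ℕ) : ZMod p) = -((20 : ℕ) : ZMod p) := by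
        have : 20 * (p - 1) + 0 + 20 = 20 * p := by omega
        have h' := congrArg (Nat.cast : ℕ → ZMod p) this
        push_cast at h' ⊢
        rw [ZMod.natCast_self, mul_zero] at h'
        linear_combination h'
      rw [e, neg_eq_zero] at h
      exact h20 h
    obtain ⟨B1, hB1, eB1, hN1⟩ := HA 1 (by omega) h1ne
    obtain ⟨Bp, hBp, eBp, hNp⟩ := HA (p - 1) (by omega) hpne
    -- `B1 ≥ p − 2`
    have hB1ge : p - 2 ≤ B1 := by omega
    -- `20 B1 + F' ≡ −20`
    have e1 : ((20 * B1 + F' + 20 : ℕ) : ZMod p) = 0 := by push_cast at eB1 ⊢; linear_combination eB1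
    rw [ZMod.natCast_eq_zero_iff] at e1
    rcases Nat.lt_or_ge B1 (p - 1) with hlt | hge
    · -- `B1 = p − 2`: `20(p−2) + F' + 20 = 20p + (F' − 20)`, so `p ∣ 20 − F'`
      have hB1eq : B1 = p - 2 := by omega
      subst hB1eq
      have hd : p ∣ 20 * p - (20 - F') := by
        have : 20 * (p - 2) + F' + 20 = 20 * p - (20 - F') := by omega
        rwa [this] at e1
      have hd' : p ∣ 20 - F' := by
        have h2 : p ∣ 20 * p := dvd_mul_left p 20
        have := (Nat.dvd_sub h2 hd)
        rwa [Nat.sub_sub_self (by omega)] at this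
      have := eq_zero_of_dvd_of_even hp h11 (n := 20 - F') (by omega) (by omega) hd'
      omega
    · -- `B1 = p − 1`: `20(p−1) + F' + 20 = 20p + F'`, so `p ∣ F'`
      have hB1eq : B1 = p - 1 := by omega
      subst hB1eq
      have hd : p ∣ 20 * p + F' := by
        have : 20 * (p - 1) + F' + 20 = 20 * p + F' := by omega
        rwa [this] at e1
      have hd' : p ∣ F' := (Nat.dvd_add_right (dvd_mul_left p 20)).mp hd
      have := eq_zero_of_dvd_of_even hp h11 (n := F') (by omega) hF'e hd'
      omega
  by_cases hP : ((20 * (p - 1) + F : ℕ) : ZMod p) = 0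
  · -- `F ≡ 20`: `p ∣ 20 − F`, impossible by parity
    rw [ZMod.natCast_eq_zero_iff] at hP
    have hd : p ∣ 20 * p - (20 - F) := by
      have : 20 * (p - 1) + F = 20 * p - (20 - F) := by omega
      rwa [this] at hP
    have hd' : p ∣ 20 - F := by
      have h2 : p ∣ 20 * p := dvd_mul_left p 20
      have := Nat.dvd_sub h2 hd
      rwa [Nat.sub_sub_self (by omega)] at this
    have := eq_zero_of_dvd_of_even hp h11 (n := 20 - F) (by omega) (by omega) hd'
    omega
  -- both `a = 0` and `a = p − 1` admissible: `N = B₀ ≤ p − 1` and `N ≥ p − 1`, so `B_{p−1} = 0` and `F + F' ≡ 20`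
  obtain ⟨B0, hB0, eB0, hN0⟩ := HA 0 (by omega) h0
  obtain ⟨Bp, hBp, eBp, hNp⟩ := HA (p - 1) (by omega) hP
  have hBp0 : Bp = 0 := by omega
  subst hBp0
  have e1 : ((F' + 20 * (p - 1) + F : ℕ) : ZMod p) = 0 := by push_cast at eBp ⊢; linear_combination eBp
  rw [ZMod.natCast_eq_zero_iff] at e1
  -- `F' + 20(p − 1) + F = 20p + (F + F' − 20)`
  rcases Nat.lt_or_ge (F + F') 20 with hlt | hge
  · have hd : p ∣ 20 * p - (20 - (F + F')) := by
      have : F' + 20 * (p - 1) + F = 20 * p - (20 - (F + F')) := by omega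
      rwa [this] at e1
    have hd' : p ∣ 20 - (F + F') := by
      have h2 : p ∣ 20 * p := dvd_mul_left p 20
      have := Nat.dvd_sub h2 hd
      rwa [Nat.sub_sub_self (by omega)] at this
    have := eq_zero_of_dvd_of_even hp h11 (n := 20 - (F + F')) (by omega) (by omega) hd'
    omega
  · have hd : p ∣ 20 * p + (F + F' - 20) := by
      have : F' + 20 * (p - 1) + F = 20 * p + (F + F' - 20) := by omega
      rwa [this] at e1
    have hd' : p ∣ F + F' - 20 := (Nat.dvd_add_right (dvd_mul_left p 20)).mp hd
    have := eq_zero_of_dvd_of_even hp h11 (n := F + F' - 20) (by omega) (by omega) hd'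
    omega

/-- **Two odd members, both in the fibre `0`:** impossible. The even members are `pt(f, c)`, `pt(f′, −c)` (`c ≠ 0`); the units
`t = pt(1, λ)` fix the odd members and move the even ones to `pt(f, μ)`, `pt(f′, −μ)`, `μ = λc`; writing `⟨pt(f, μ)⟩ = 20A + ⟨f⟩`,
`⟨pt(f′, −μ)⟩ = 20B + ⟨f′⟩`, the norm equations say that `A + B` is independent of `μ ≠ 0` — `step_contra`.
[cite: Shioda1979PJA, §1 eq. (2)] -/
private theorem case_two_odd_fibre (h : Nat.Coprime 20 p) [NeZero (20 * p)] (hp : p.Prime) (h19 : 19 ≤ p)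
    {s : Multiset (ZMod (20 * p))} (hs : IsHodgeMultiset s) (hpf : ∀ a ∈ s, ∀ b ∈ s.erase a, a + b ≠ 0)
    {x y z w : ZMod (20 * p)} (hsx : s = {x, y, z, w})
    (hz0 : z.val % 2 = 0) (hw0 : w.val % 2 = 0) (hxc : (crt h x).2 = 0) (hyc : (crt h y).2 = 0)
    (hzc : (crt h z).2 ≠ 0) : False := by
  classical
  haveI := Fact.mk hp
  have h20 := twenty_ne_zero h hp
  have hz : z ∈ s := by rw [hsx]; simp
  have hwz : w ∈ s.erase z := by
    rw [hsx, show ({x, y, z, w} : Multiset (ZMod (20 * p))) = {z, x, y, w} by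
      simp only [Multiset.insert_eq_cons, ← Multiset.singleton_add]; abel, Multiset.insert_eq_cons,
      Multiset.erase_cons_head]
    simp
  -- coordinates
  obtain ⟨e₁, rfl⟩ : ∃ e₁, x = pt h e₁ 0 := ⟨(crt h x).1, by conv_lhs => rw [← pt_crt h x, hxc]⟩
  obtain ⟨e₂, rfl⟩ : ∃ e₂, y = pt h e₂ 0 := ⟨(crt h y).1, by conv_lhs => rw [← pt_crt h y, hyc]⟩
  obtain ⟨f, c, rfl⟩ : ∃ f c, z = pt h f c := ⟨_, _, (pt_crt h z).symm⟩
  obtain ⟨f', c', rfl⟩ : ∃ f' c', w = pt h f' c' := ⟨_, _, (pt_crt h w).symm⟩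
  simp only [crt_pt] at hzc
  have hc' : c' = -c := by
    have := congrArg (fun v ↦ (crt h v).2) hs.1.2
    simp only [hsx, Multiset.insert_eq_cons, Multiset.sum_cons, Multiset.sum_singleton, _root_.map_add, Prod.snd_add, crt_pt,
      _root_.map_zero, Prod.snd_zero] at this
    linear_combination this
  subst hc'
  have hf : f.val % 2 = 0 := by rwa [val_pt_mod_two] at hz0
  have hf' : f'.val % 2 = 0 := by rwa [val_pt_mod_two] at hw0
  -- no pair: `f + f' ≠ 0`, i.e. `⟨f⟩ + ⟨f'⟩ ∉ {0, 20}`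
  have hff : f + f' ≠ 0 := by
    intro e
    apply hpf _ hz _ hwz
    rw [pt_add, e, add_neg_cancel, pt_zero]
  have hvf := ZMod.val_lt f
  have hvf' := ZMod.val_lt f'
  have hS : f.val + f'.val ≠ 0 ∧ f.val + f'.val ≠ 20 := by
    have key : (((f.val + f'.val : ℕ)) : ZMod 20) ≠ 0 := by
      rw [Nat.cast_add, ZMod.natCast_zmod_val, ZMod.natCast_zmod_val]; exact hff
    constructor
    · intro e; apply key; rw [e, Nat.cast_zero]
    · intro e; apply key; rw [e]; rfl
  -- the norm equations at the units `pt(1, λ)`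
  set N : ℕ := (40 * p - (pt h e₁ 0).val - (pt h e₂ 0).val - f.val - f'.val) / 20 with hN
  refine step_contra hp (by omega) h20 hvf hvf' hf hf' hS.1 hS.2 (N := N) fun μ hμ ↦ ?_
  obtain ⟨t, ht⟩ := isUnit_pt_one h hp (b := μ * c⁻¹) (mul_ne_zero hμ (inv_ne_zero hzc))
  have key := hs.2 t
  rw [hsx] at key
  simp only [Multiset.insert_eq_cons, Multiset.map_cons, Multiset.map_singleton, Multiset.card_cons, Multiset.card_singleton,
    mNormSum_cons, ht, pt_mul, one_mul, mul_zero, mul_neg, inv_mul_cancel_right₀ hzc] at key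
  simp only [mNormSum, Multiset.map_singleton, Multiset.sum_singleton] at key
  have hA := Nat.div_add_mod (pt h f μ).val 20
  have hB := Nat.div_add_mod (pt h f' (-μ)).val 20
  rw [val_pt_mod_twenty] at hA hB
  have hAlt := ZMod.val_lt (pt h f μ)
  have hBlt := ZMod.val_lt (pt h f' (-μ))
  refine ⟨(pt h f μ).val / 20, (pt h f' (-μ)).val / 20, by omega, by omega, ?_, ?_, by omega⟩
  · rw [hA, natCast_val_pt]
  · rw [hB, natCast_val_pt]

/-! ### Case 0: all members in the fibre `0` — the level `20` -/

/-- The level-`20` multiset `{k₁, k₂, k₃, −(k₁ + k₂ + k₃)}`. [folklore] -/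
private def lev (k₁ k₂ k₃ : ZMod 20) : Multiset (ZMod 20) := {k₁, k₂, k₃, -(k₁ + k₂ + k₃)}

/-- The `42` pair-free Hodge quadruples of level `20`, by representatives `0 ≤ k < 20` (kernel-enumerated below; `8 + 8` of the
standard types `α`, `β` and the four unit orbits, of sizes `8, 8, 2, 8`, of `(1, 4, 17, 18)`, `(1, 6, 16, 17)`, `(1, 9, 13, 17)`,
`(1, 10, 12, 17)` — the rows of Tabelle 1 at `N = 20`; Shioda's `Δ(20) = 26`).
[cite: MeyerNeutsch1981Fermatquadrupel, Tabelle 1 p. 54 (N = 20)] [cite: Shioda1982PicardFermat, table p. 727 (m = 20)] -/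
private def table20 : List (Multiset (ZMod 20)) :=
  [{1, 4, 17, 18}, {1, 6, 16, 17}, {1, 8, 13, 18}, {1, 9, 13, 17}, {1, 10, 11, 18}, {1, 10, 12, 17}, {1, 10, 13, 16},
    {1, 11, 12, 16}, {1, 12, 13, 14}, {2, 3, 16, 19}, {2, 6, 16, 16}, {2, 7, 12, 19}, {2, 9, 10, 19}, {2, 9, 12, 17},
    {2, 9, 13, 16}, {2, 10, 12, 16}, {2, 12, 12, 14}, {3, 4, 14, 19}, {3, 7, 11, 19}, {3, 8, 10, 19}, {3, 8, 11, 18},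
    {3, 8, 13, 16}, {3, 10, 11, 16}, {3, 10, 13, 14}, {3, 11, 12, 14}, {4, 4, 14, 18}, {4, 7, 10, 19},
    {4, 7, 11, 18}, {4, 7, 12, 17}, {4, 8, 9, 19}, {4, 8, 10, 18}, {4, 9, 10, 17}, {4, 9, 13, 14}, {4, 10, 12, 14},
    {6, 7, 8, 19}, {6, 7, 10, 17}, {6, 7, 11, 16}, {6, 8, 8, 18}, {6, 8, 9, 17}, {6, 8, 10, 16}, {7, 10, 11, 12},
    {8, 9, 10, 13}]

set_option maxHeartbeats 0 in
set_option maxRecDepth 16384 in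
set_option synthInstance.maxHeartbeats 0 in
set_option synthInstance.maxSize 4096 in
/-- `level_twenty_pairfree`, slice `k₁ = 1` (kernel enumeration of the `20²` pairs). [folklore] -/
private theorem lev20_slice_1 : ∀ k₂ k₃ : ZMod 20,
    (1 : ZMod 20).val ≤ k₂.val → (1 : ZMod 20).val ≤ k₃.val → (1 : ZMod 20).val ≤ (-(1 + k₂ + k₃)).val →
    ((lev 1 k₂ k₃).map ZMod.val).sum = 40 → (∀ a ∈ lev 1 k₂ k₃, a ≠ 0) →
    ((lev 1 k₂ k₃).map fun k ↦ (3 * k).val).sum = 40 →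
    ((lev 1 k₂ k₃).map fun k ↦ (7 * k).val).sum = 40 →
    ((lev 1 k₂ k₃).map fun k ↦ (9 * k).val).sum = 40 →
    (∀ a ∈ lev 1 k₂ k₃, ∀ b ∈ (lev 1 k₂ k₃).erase a, a + b ≠ 0) →
    lev 1 k₂ k₃ ∈ table20 := by
  decide +kernel

set_option maxHeartbeats 0 in
set_option maxRecDepth 16384 in
set_option synthInstance.maxHeartbeats 0 in
set_option synthInstance.maxSize 4096 in
/-- `level_twenty_pairfree`, slice `k₁ = 2` (kernel enumeration of the `20²` pairs). [folklore] -/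
private theorem lev20_slice_2 : ∀ k₂ k₃ : ZMod 20,
    (2 : ZMod 20).val ≤ k₂.val → (2 : ZMod 20).val ≤ k₃.val → (2 : ZMod 20).val ≤ (-(2 + k₂ + k₃)).val →
    ((lev 2 k₂ k₃).map ZMod.val).sum = 40 → (∀ a ∈ lev 2 k₂ k₃, a ≠ 0) →
    ((lev 2 k₂ k₃).map fun k ↦ (3 * k).val).sum = 40 →
    ((lev 2 k₂ k₃).map fun k ↦ (7 * k).val).sum = 40 →
    ((lev 2 k₂ k₃).map fun k ↦ (9 * k).val).sum = 40 →
    (∀ a ∈ lev 2 k₂ k₃, ∀ b ∈ (lev 2 k₂ k₃).erase a, a + b ≠ 0) →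
    lev 2 k₂ k₃ ∈ table20 := by
  decide +kernel

set_option maxHeartbeats 0 in
set_option maxRecDepth 16384 in
set_option synthInstance.maxHeartbeats 0 in
set_option synthInstance.maxSize 4096 in
/-- `level_twenty_pairfree`, slice `k₁ = 3` (kernel enumeration of the `20²` pairs). [folklore] -/
private theorem lev20_slice_3 : ∀ k₂ k₃ : ZMod 20,
    (3 : ZMod 20).val ≤ k₂.val → (3 : ZMod 20).val ≤ k₃.val → (3 : ZMod 20).val ≤ (-(3 + k₂ + k₃)).val →
    ((lev 3 k₂ k₃).map ZMod.val).sum = 40 → (∀ a ∈ lev 3 k₂ k₃, a ≠ 0) →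
    ((lev 3 k₂ k₃).map fun k ↦ (3 * k).val).sum = 40 →
    ((lev 3 k₂ k₃).map fun k ↦ (7 * k).val).sum = 40 →
    ((lev 3 k₂ k₃).map fun k ↦ (9 * k).val).sum = 40 →
    (∀ a ∈ lev 3 k₂ k₃, ∀ b ∈ (lev 3 k₂ k₃).erase a, a + b ≠ 0) →
    lev 3 k₂ k₃ ∈ table20 := by
  decide +kernel

set_option maxHeartbeats 0 in
set_option maxRecDepth 16384 in
set_option synthInstance.maxHeartbeats 0 in
set_option synthInstance.maxSize 4096 in
/-- `level_twenty_pairfree`, slice `k₁ = 4` (kernel enumeration of the `20²` pairs). [folklore] -/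
private theorem lev20_slice_4 : ∀ k₂ k₃ : ZMod 20,
    (4 : ZMod 20).val ≤ k₂.val → (4 : ZMod 20).val ≤ k₃.val → (4 : ZMod 20).val ≤ (-(4 + k₂ + k₃)).val →
    ((lev 4 k₂ k₃).map ZMod.val).sum = 40 → (∀ a ∈ lev 4 k₂ k₃, a ≠ 0) →
    ((lev 4 k₂ k₃).map fun k ↦ (3 * k).val).sum = 40 →
    ((lev 4 k₂ k₃).map fun k ↦ (7 * k).val).sum = 40 →
    ((lev 4 k₂ k₃).map fun k ↦ (9 * k).val).sum = 40 →
    (∀ a ∈ lev 4 k₂ k₃, ∀ b ∈ (lev 4 k₂ k₃).erase a, a + b ≠ 0) →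
    lev 4 k₂ k₃ ∈ table20 := by
  decide +kernel

set_option maxHeartbeats 0 in
set_option maxRecDepth 16384 in
set_option synthInstance.maxHeartbeats 0 in
set_option synthInstance.maxSize 4096 in
/-- `level_twenty_pairfree`, slice `k₁ = 5` (kernel enumeration of the `20²` pairs). [folklore] -/
private theorem lev20_slice_5 : ∀ k₂ k₃ : ZMod 20,
    (5 : ZMod 20).val ≤ k₂.val → (5 : ZMod 20).val ≤ k₃.val → (5 : ZMod 20).val ≤ (-(5 + k₂ + k₃)).val →
    ((lev 5 k₂ k₃).map ZMod.val).sum = 40 → (∀ a ∈ lev 5 k₂ k₃, a ≠ 0) →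
    ((lev 5 k₂ k₃).map fun k ↦ (3 * k).val).sum = 40 →
    ((lev 5 k₂ k₃).map fun k ↦ (7 * k).val).sum = 40 →
    ((lev 5 k₂ k₃).map fun k ↦ (9 * k).val).sum = 40 →
    (∀ a ∈ lev 5 k₂ k₃, ∀ b ∈ (lev 5 k₂ k₃).erase a, a + b ≠ 0) →
    lev 5 k₂ k₃ ∈ table20 := by
  decide +kernel

set_option maxHeartbeats 0 in
set_option maxRecDepth 16384 in
set_option synthInstance.maxHeartbeats 0 in
set_option synthInstance.maxSize 4096 in
/-- `level_twenty_pairfree`, slice `k₁ = 6` (kernel enumeration of the `20²` pairs). [folklore] -/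
private theorem lev20_slice_6 : ∀ k₂ k₃ : ZMod 20,
    (6 : ZMod 20).val ≤ k₂.val → (6 : ZMod 20).val ≤ k₃.val → (6 : ZMod 20).val ≤ (-(6 + k₂ + k₃)).val →
    ((lev 6 k₂ k₃).map ZMod.val).sum = 40 → (∀ a ∈ lev 6 k₂ k₃, a ≠ 0) →
    ((lev 6 k₂ k₃).map fun k ↦ (3 * k).val).sum = 40 →
    ((lev 6 k₂ k₃).map fun k ↦ (7 * k).val).sum = 40 →
    ((lev 6 k₂ k₃).map fun k ↦ (9 * k).val).sum = 40 →
    (∀ a ∈ lev 6 k₂ k₃, ∀ b ∈ (lev 6 k₂ k₃).erase a, a + b ≠ 0) →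
    lev 6 k₂ k₃ ∈ table20 := by
  decide +kernel

set_option maxHeartbeats 0 in
set_option maxRecDepth 16384 in
set_option synthInstance.maxHeartbeats 0 in
set_option synthInstance.maxSize 4096 in
/-- `level_twenty_pairfree`, slice `k₁ = 7` (kernel enumeration of the `20²` pairs). [folklore] -/
private theorem lev20_slice_7 : ∀ k₂ k₃ : ZMod 20,
    (7 : ZMod 20).val ≤ k₂.val → (7 : ZMod 20).val ≤ k₃.val → (7 : ZMod 20).val ≤ (-(7 + k₂ + k₃)).val →
    ((lev 7 k₂ k₃).map ZMod.val).sum = 40 → (∀ a ∈ lev 7 k₂ k₃, a ≠ 0) →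
    ((lev 7 k₂ k₃).map fun k ↦ (3 * k).val).sum = 40 →
    ((lev 7 k₂ k₃).map fun k ↦ (7 * k).val).sum = 40 →
    ((lev 7 k₂ k₃).map fun k ↦ (9 * k).val).sum = 40 →
    (∀ a ∈ lev 7 k₂ k₃, ∀ b ∈ (lev 7 k₂ k₃).erase a, a + b ≠ 0) →
    lev 7 k₂ k₃ ∈ table20 := by
  decide +kernel

set_option maxHeartbeats 0 in
set_option maxRecDepth 16384 in
set_option synthInstance.maxHeartbeats 0 in
set_option synthInstance.maxSize 4096 in
/-- `level_twenty_pairfree`, slice `k₁ = 8` (kernel enumeration of the `20²` pairs). [folklore] -/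
private theorem lev20_slice_8 : ∀ k₂ k₃ : ZMod 20,
    (8 : ZMod 20).val ≤ k₂.val → (8 : ZMod 20).val ≤ k₃.val → (8 : ZMod 20).val ≤ (-(8 + k₂ + k₃)).val →
    ((lev 8 k₂ k₃).map ZMod.val).sum = 40 → (∀ a ∈ lev 8 k₂ k₃, a ≠ 0) →
    ((lev 8 k₂ k₃).map fun k ↦ (3 * k).val).sum = 40 →
    ((lev 8 k₂ k₃).map fun k ↦ (7 * k).val).sum = 40 →
    ((lev 8 k₂ k₃).map fun k ↦ (9 * k).val).sum = 40 →
    (∀ a ∈ lev 8 k₂ k₃, ∀ b ∈ (lev 8 k₂ k₃).erase a, a + b ≠ 0) →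
    lev 8 k₂ k₃ ∈ table20 := by
  decide +kernel

set_option maxHeartbeats 0 in
set_option maxRecDepth 16384 in
set_option synthInstance.maxHeartbeats 0 in
set_option synthInstance.maxSize 4096 in
/-- `level_twenty_pairfree`, slice `k₁ = 9` (kernel enumeration of the `20²` pairs). [folklore] -/
private theorem lev20_slice_9 : ∀ k₂ k₃ : ZMod 20,
    (9 : ZMod 20).val ≤ k₂.val → (9 : ZMod 20).val ≤ k₃.val → (9 : ZMod 20).val ≤ (-(9 + k₂ + k₃)).val →
    ((lev 9 k₂ k₃).map ZMod.val).sum = 40 → (∀ a ∈ lev 9 k₂ k₃, a ≠ 0) →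
    ((lev 9 k₂ k₃).map fun k ↦ (3 * k).val).sum = 40 →
    ((lev 9 k₂ k₃).map fun k ↦ (7 * k).val).sum = 40 →
    ((lev 9 k₂ k₃).map fun k ↦ (9 * k).val).sum = 40 →
    (∀ a ∈ lev 9 k₂ k₃, ∀ b ∈ (lev 9 k₂ k₃).erase a, a + b ≠ 0) →
    lev 9 k₂ k₃ ∈ table20 := by
  decide +kernel

set_option maxHeartbeats 0 in
set_option maxRecDepth 16384 in
set_option synthInstance.maxHeartbeats 0 in
set_option synthInstance.maxSize 4096 in
/-- `level_twenty_pairfree`, slice `k₁ = 10` (kernel enumeration of the `20²` pairs). [folklore] -/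
private theorem lev20_slice_10 : ∀ k₂ k₃ : ZMod 20,
    (10 : ZMod 20).val ≤ k₂.val → (10 : ZMod 20).val ≤ k₃.val → (10 : ZMod 20).val ≤ (-(10 + k₂ + k₃)).val →
    ((lev 10 k₂ k₃).map ZMod.val).sum = 40 → (∀ a ∈ lev 10 k₂ k₃, a ≠ 0) →
    ((lev 10 k₂ k₃).map fun k ↦ (3 * k).val).sum = 40 →
    ((lev 10 k₂ k₃).map fun k ↦ (7 * k).val).sum = 40 →
    ((lev 10 k₂ k₃).map fun k ↦ (9 * k).val).sum = 40 →
    (∀ a ∈ lev 10 k₂ k₃, ∀ b ∈ (lev 10 k₂ k₃).erase a, a + b ≠ 0) →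
    lev 10 k₂ k₃ ∈ table20 := by
  decide +kernel

/-- The non-zero residues mod `20` of representative `≤ 10`. [folklore] -/
private theorem val_le_ten_cases : ∀ k : ZMod 20, k.val ≤ 10 → k ≠ 0 → k = 1 ∨ k = 2 ∨ k = 3 ∨ k = 4 ∨ k = 5 ∨ k = 6 ∨
    k = 7 ∨ k = 8 ∨ k = 9 ∨ k = 10 := by
  decide

/-- **The pair-free Hodge quadruples of level `20`** (kernel enumeration, by slices `k₁ = 1, …, 10` of a member of least
representative): a `4`-multiset of non-zero residues mod `20` with `Σ = 0`, satisfying the four norm equations `Σ⟨u k⟩ = 40`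
(`u = 1, 3, 7, 9`; those at `−u` follow) and without a pair is one of the `42` multisets of `table20`.
[cite: MeyerNeutsch1981Fermatquadrupel, Tabelle 1 p. 54 (N = 20)] [cite: Shioda1982PicardFermat, table p. 727 (m = 20, Δ(20) = 26)] -/
private theorem level_twenty_pairfree (k₁ k₂ k₃ : ZMod 20) (h10 : k₁.val ≤ 10) (ho₂ : k₁.val ≤ k₂.val)
    (ho₃ : k₁.val ≤ k₃.val) (ho₄ : k₁.val ≤ (-(k₁ + k₂ + k₃)).val) (hsum : ((lev k₁ k₂ k₃).map ZMod.val).sum = 40)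
    (hM0 : ∀ a ∈ lev k₁ k₂ k₃, a ≠ 0) (hn3 : ((lev k₁ k₂ k₃).map fun k ↦ (3 * k).val).sum = 40)
    (hn7 : ((lev k₁ k₂ k₃).map fun k ↦ (7 * k).val).sum = 40)
    (hn9 : ((lev k₁ k₂ k₃).map fun k ↦ (9 * k).val).sum = 40)
    (hpf : ∀ a ∈ lev k₁ k₂ k₃, ∀ b ∈ (lev k₁ k₂ k₃).erase a, a + b ≠ 0) : lev k₁ k₂ k₃ ∈ table20 := by
  have h0 : k₁ ≠ 0 := hM0 k₁ (by simp [lev])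
  rcases val_le_ten_cases k₁ h10 h0 with rfl | rfl | rfl | rfl | rfl | rfl | rfl | rfl | rfl | rfl
  exacts [lev20_slice_1 k₂ k₃ ho₂ ho₃ ho₄ hsum hM0 hn3 hn7 hn9 hpf,
    lev20_slice_2 k₂ k₃ ho₂ ho₃ ho₄ hsum hM0 hn3 hn7 hn9 hpf,
    lev20_slice_3 k₂ k₃ ho₂ ho₃ ho₄ hsum hM0 hn3 hn7 hn9 hpf,
    lev20_slice_4 k₂ k₃ ho₂ ho₃ ho₄ hsum hM0 hn3 hn7 hn9 hpf,
    lev20_slice_5 k₂ k₃ ho₂ ho₃ ho₄ hsum hM0 hn3 hn7 hn9 hpf,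
    lev20_slice_6 k₂ k₃ ho₂ ho₃ ho₄ hsum hM0 hn3 hn7 hn9 hpf,
    lev20_slice_7 k₂ k₃ ho₂ ho₃ ho₄ hsum hM0 hn3 hn7 hn9 hpf,
    lev20_slice_8 k₂ k₃ ho₂ ho₃ ho₄ hsum hM0 hn3 hn7 hn9 hpf,
    lev20_slice_9 k₂ k₃ ho₂ ho₃ ho₄ hsum hM0 hn3 hn7 hn9 hpf,
    lev20_slice_10 k₂ k₃ ho₂ ho₃ ho₄ hsum hM0 hn3 hn7 hn9 hpf]

set_option maxHeartbeats 0 in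
set_option maxRecDepth 16384 in
set_option synthInstance.maxHeartbeats 0 in
set_option synthInstance.maxSize 4096 in
/-- **The `42` quadruples by type:** `{k, k + 10, −2k, 10}` (`α`), `{k, k + 10, 2k + 10, −4k}` (`β`), or a unit multiple `u·r` of one
of the four rows `(1, 4, 17, 18)`, `(1, 6, 16, 17)`, `(1, 9, 13, 17)`, `(1, 10, 12, 17)` of Tabelle 1 at `N = 20` (orbit sizes
`8, 8, 2, 8`; Shioda's `Δ(20) = 26`, table p. 727). Kernel check.
[cite: MeyerNeutsch1981Fermatquadrupel, Tabelle 1 p. 54 (N = 20)] [cite: Shioda1982PicardFermat, table p. 727 (m = 20)] -/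
private theorem table20_forms : ∀ M ∈ table20, ∃ k : ZMod 20, M = {k, k + 10, -(2 * k), 10} ∨
    M = {k, k + 10, 2 * k + 10, -(4 * k)} ∨
    ((k = 1 ∨ k = 3 ∨ k = 7 ∨ k = 9 ∨ k = 11 ∨ k = 13 ∨ k = 17 ∨ k = 19) ∧
      (M = {k, 4 * k, 17 * k, 18 * k} ∨ M = {k, 6 * k, 16 * k, 17 * k} ∨ M = {k, 9 * k, 13 * k, 17 * k} ∨
        M = {k, 10 * k, 12 * k, 17 * k})) := by
  decide +kernel

/-- The units of `ℤ/20` by representative. [folklore] -/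
private theorem unit_val {k : ZMod 20} (hk : k = 1 ∨ k = 3 ∨ k = 7 ∨ k = 9 ∨ k = 11 ∨ k = 13 ∨ k = 17 ∨ k = 19) :
    k.val = 1 ∨ k.val = 3 ∨ k.val = 7 ∨ k.val = 9 ∨ k.val = 11 ∨ k.val = 13 ∨ k.val = 17 ∨ k.val = 19 := by
  rcases hk with rfl | rfl | rfl | rfl | rfl | rfl | rfl | rfl <;> decide

/-- `φ k = pt(kπ, 0)`: the multiple `⟨k⟩·p` of `p` in `ℤ/20p`. [folklore] -/
private def phi (h : Nat.Coprime 20 p) (k : ZMod 20) : ZMod (20 * p) := pt h (k * π) 0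

/-- `φ` is additive. [folklore] -/
private theorem phi_add (h : Nat.Coprime 20 p) (a b : ZMod 20) : phi h (a + b) = phi h a + phi h b := by
  unfold phi; rw [add_mul, pt_add, add_zero]

/-- `φ(−a) = −φ a`. [folklore] -/
private theorem phi_neg (h : Nat.Coprime 20 p) (a : ZMod 20) : phi h (-a) = -phi h a := by
  unfold phi; rw [neg_pt, neg_zero, neg_mul]

/-- `φ(n a) = n φ a`. [folklore] -/
private theorem phi_natCast_mul (h : Nat.Coprime 20 p) (n : ℕ) (a : ZMod 20) :
    phi h (n * a) = (n : ZMod (20 * p)) * phi h a := by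
  unfold phi; rw [natCast_mul_pt, mul_zero, mul_assoc]

/-- `φ(n a) = n φ a` for a numeral `n`. [folklore] -/
private theorem phi_ofNat_mul (h : Nat.Coprime 20 p) (n : ℕ) [n.AtLeastTwo] (a : ZMod 20) :
    phi h ((ofNat(n) : ZMod 20) * a) = (ofNat(n) : ZMod (20 * p)) * phi h a := by
  exact_mod_cast phi_natCast_mul h (OfNat.ofNat n) a

/-- `φ 10 = 10p`. [folklore] -/
private theorem phi_ten (h : Nat.Coprime 20 p) [NeZero (20 * p)] (hp : p.Prime) (h7 : 7 ≤ p) : phi h 10 = K20 := by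
  unfold phi; rw [ten_mul_pi hp h7, tenP_eq_pt h hp h7]

/-- `φ k = ⟨k⟩p`. [folklore] -/
private theorem phi_eq_natCast (h : Nat.Coprime 20 p) [NeZero (20 * p)] (k : ZMod 20) :
    phi h k = ((k.val * p : ℕ) : ZMod (20 * p)) := by
  unfold phi; rw [natCast_mul_P h, ZMod.natCast_zmod_val]

/-- `⟨φ k⟩ = ⟨k⟩ p`. [folklore] -/
private theorem val_phi (h : Nat.Coprime 20 p) [NeZero (20 * p)] (hp : 0 < p) (k : ZMod 20) : (phi h k).val = k.val * p := by
  rw [phi_eq_natCast, ZMod.val_natCast, Nat.mod_eq_of_lt (by have := ZMod.val_lt k; nlinarith)]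

/-- `ψ w = (w mod 20)·π⁻¹`, an additive map `ℤ/20p → ℤ/20` inverting `φ` on the fibre `0`. [folklore] -/
private def psi (h : Nat.Coprime 20 p) : ZMod (20 * p) →+ ZMod 20 where
  toFun w := (crt h w).1 * (π)⁻¹
  map_zero' := by simp only [_root_.map_zero, Prod.fst_zero, zero_mul]
  map_add' a b := by simp only [_root_.map_add, Prod.fst_add, add_mul]

/-- Unfolding `ψ`. [folklore] -/
private theorem psi_apply (h : Nat.Coprime 20 p) (w : ZMod (20 * p)) : psi h w = (crt h w).1 * (π)⁻¹ := rfl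

/-- `π π⁻¹ = 1` in `ℤ/20`. [folklore] -/
private theorem pi_mul_inv (h : Nat.Coprime 20 p) : π * (π)⁻¹ = 1 := ZMod.coe_mul_inv_eq_one p h.symm

/-- `φ(ψ w) = w` on the fibre `0`. [folklore] -/
private theorem phi_psi (h : Nat.Coprime 20 p) [NeZero (20 * p)] {w : ZMod (20 * p)}
    (hw : (crt h w).2 = 0) : phi h (psi h w) = w := by
  rw [psi_apply, phi, mul_assoc, mul_comm _ π, pi_mul_inv h, mul_one]
  conv_rhs => rw [← pt_crt h w, hw]

/-- On the fibre `0`, `ψ w = 0` forces `w = 0`. [folklore] -/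
private theorem eq_zero_of_psi (h : Nat.Coprime 20 p) [NeZero (20 * p)] {w : ZMod (20 * p)}
    (hw : (crt h w).2 = 0) (h0 : psi h w = 0) : w = 0 := by
  rw [← phi_psi h hw, h0, phi, zero_mul, pt_zero]

/-- **All members in the fibre `0`** (multiples of `p`): `s = φ(M)` for a pair-free Hodge quadruple `M` of level `20` (the norm
equation of `s` at the unit `pt(u, 1)` is the norm equation of `M` at `u`), read off from `level_twenty_pairfree` and
`table20_forms`. [cite: Shioda1982PicardFermat, §2 p. 726 (𝔍²ₘ(d) ≅ 𝔍²_{m/d}(1)) and table p. 727 (m = 20)]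
[cite: MeyerNeutsch1981Fermatquadrupel, Tabelle 1 p. 54 (N = 20)] -/
private theorem fibre_zero (h : Nat.Coprime 20 p) [NeZero (20 * p)] (hp : p.Prime) (h19 : 19 ≤ p)
    {s : Multiset (ZMod (20 * p))} (hs : IsHodgeMultiset s) (hcard : Multiset.card s = 4)
    (hind : ∀ a ∈ s, ∀ b ∈ s.erase a, a + b ≠ 0) (h0 : ∀ w ∈ s, (crt h w).2 = 0) :
    ∃ x : ZMod (20 * p), s = {x, x + K20, -(2 * x), K20} ∨ s = {x, x + K20, 2 * x + K20, -(4 * x)} ∨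
      ((∃ t : ℕ, (t = 1 ∨ t = 3 ∨ t = 7 ∨ t = 9 ∨ t = 11 ∨ t = 13 ∨ t = 17 ∨ t = 19) ∧ x = ((t * p : ℕ) : ZMod (20 * p))) ∧
        (s = {x, 4 * x, 17 * x, 18 * x} ∨ s = {x, 6 * x, 16 * x, 17 * x} ∨ s = {x, 9 * x, 13 * x, 17 * x} ∨
          s = {x, 10 * x, 12 * x, 17 * x})) := by
  classical
  have h7 : 7 ≤ p := by omega
  have hp0 := hp.pos
  set M := s.map (psi h) with hM
  have hsM : s = M.map (phi h) := by
    rw [hM, Multiset.map_map]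
    conv_lhs => rw [← Multiset.map_id s]
    refine Multiset.map_congr rfl fun w hw ↦ ?_
    simp only [Function.comp_apply, id]
    exact (phi_psi h (h0 w hw)).symm
  have hcM : Multiset.card M = 4 := by rw [hM, Multiset.card_map, hcard]
  -- (i) non-zero
  have hM0 : ∀ a ∈ M, a ≠ 0 := by
    intro a ha ha0
    rw [hM] at ha
    obtain ⟨w, hw, rfl⟩ := Multiset.mem_map.mp ha
    exact hs.1.1 w hw (eq_zero_of_psi h (h0 w hw) ha0)
  -- (ii) no pair
  have hMpf : ∀ a ∈ M, ∀ b ∈ M.erase a, a + b ≠ 0 := by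
    intro a ha b hb hab
    rw [hM] at ha
    obtain ⟨w, hw, rfl⟩ := Multiset.mem_map.mp ha
    rw [hM, ← Multiset.map_erase_of_mem _ _ hw] at hb
    obtain ⟨w', hw', rfl⟩ := Multiset.mem_map.mp hb
    have hw's : w' ∈ s := Multiset.mem_of_mem_erase hw'
    refine hind w hw w' hw' (eq_zero_of_psi h ?_ ?_)
    · rw [_root_.map_add, Prod.snd_add, h0 w hw, h0 w' hw's, add_zero]
    · rw [_root_.map_add, hab]
  -- (iii) the norm equations at the units `pt(u, 1)`
  have hnormM : ∀ u v : ZMod 20, u * v = 1 → (M.map fun k ↦ (u * k).val).sum = 40 := by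
    intro u v hu
    obtain ⟨t, ht⟩ := isUnit_pt h hu
    have key := hs.2 t
    rw [hcard, hsM, Multiset.map_map] at key
    have e : (M.map ((fun x ↦ (t : ZMod (20 * p)) * x) ∘ phi h)) = M.map (fun k ↦ phi h (u * k)) := by
      refine Multiset.map_congr rfl fun k _ ↦ ?_
      simp only [Function.comp_apply, ht, phi]
      rw [pt_mul, one_mul, mul_assoc]
    rw [e, mNormSum, Multiset.map_map] at key
    have e2 : (M.map (ZMod.val ∘ fun k ↦ phi h (u * k))) = M.map (fun k ↦ (u * k).val * p) := by
      refine Multiset.map_congr rfl fun k _ ↦ ?_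
      simp only [Function.comp_apply, val_phi h hp0]
    rw [e2, Multiset.sum_map_mul_right] at key
    have : (M.map fun k ↦ (u * k).val).sum * p = 40 * p := by linarith
    exact Nat.eq_of_mul_eq_mul_right hp0 this
  -- (iv) enumerate `M` from a member of least representative and apply `level_twenty_pairfree`
  obtain ⟨k₀, hk₀⟩ := Multiset.card_pos_iff_exists_mem.mp (by omega : 0 < Multiset.card M)
  obtain ⟨k₁, hk₁', hmin⟩ := Finset.exists_min_image M.toFinset ZMod.val ⟨k₀, Multiset.mem_toFinset.mpr hk₀⟩
  have hk₁ : k₁ ∈ M := Multiset.mem_toFinset.mp hk₁'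
  have hmin' : ∀ a ∈ M, k₁.val ≤ a.val := fun a ha ↦ hmin a (Multiset.mem_toFinset.mpr ha)
  have hct : Multiset.card (M.erase k₁) = 3 := by rw [Multiset.card_erase_of_mem hk₁, hcM]; rfl
  obtain ⟨k₂, k₃, k₄, ht⟩ := Multiset.card_eq_three.mp hct
  have hMk : M = {k₁, k₂, k₃, k₄} := by rw [← Multiset.cons_erase hk₁, ht]; rfl
  have hsum : M.sum = 0 := by rw [hM, ← map_multiset_sum, hs.1.2, _root_.map_zero]
  have hk₄ : k₄ = -(k₁ + k₂ + k₃) := by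
    rw [hMk] at hsum
    simp only [Multiset.insert_eq_cons, Multiset.sum_cons, Multiset.sum_singleton] at hsum
    linear_combination hsum
  have hML : M = lev k₁ k₂ k₃ := by rw [hMk, hk₄]; rfl
  rw [hML] at hM0 hMpf hnormM hmin'
  have h1 := hnormM 1 1 (one_mul 1)
  simp only [one_mul] at h1
  have ho₂ : k₁.val ≤ k₂.val := hmin' k₂ (by simp [lev])
  have ho₃ : k₁.val ≤ k₃.val := hmin' k₃ (by simp [lev])
  have ho₄ : k₁.val ≤ (-(k₁ + k₂ + k₃)).val := hmin' _ (by simp [lev])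
  have h10 : k₁.val ≤ 10 := by
    have h1' := h1
    simp only [lev, Multiset.insert_eq_cons, Multiset.map_cons, Multiset.map_singleton, Multiset.sum_cons,
      Multiset.sum_singleton] at h1'
    omega
  have hmem := level_twenty_pairfree k₁ k₂ k₃ h10 ho₂ ho₃ ho₄ h1 hM0 (hnormM 3 7 (by decide)) (hnormM 7 3 (by decide))
    (hnormM 9 9 (by decide)) hMpf
  obtain ⟨k, hk⟩ := table20_forms _ hmem
  refine ⟨phi h k, ?_⟩
  rw [hsM, hML]
  rcases hk with e | e | ⟨hkk, e⟩
  · left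
    rw [e]
    simp only [Multiset.insert_eq_cons, Multiset.map_cons, Multiset.map_singleton, phi_add, phi_neg, phi_ofNat_mul,
      phi_ten h hp h7]
  · right; left
    rw [e]
    simp only [Multiset.insert_eq_cons, Multiset.map_cons, Multiset.map_singleton, phi_add, phi_neg, phi_ofNat_mul,
      phi_ten h hp h7]
  · right; right
    refine ⟨⟨k.val, unit_val hkk, phi_eq_natCast h k⟩, ?_⟩
    rcases e with e | e | e | e <;> rw [e] <;>
      simp only [Multiset.insert_eq_cons, Multiset.map_cons, Multiset.map_singleton, phi_ofNat_mul, true_or, or_true]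

/-! ### Case II: two odd members -/

/-- **Two odd members, one off the fibre `0`:** the odd members are `x, x + 10p` (`two_odd_core`), `T(s) = 2·{x̄, ẑ, ŵ}` and
`{x̄, ẑ, ŵ, 5p}` is a Hodge quadruple of level `10p`; it has a pair exactly when `s = α_x`, and otherwise it is the level-`10p`
`α_y` with `y ∈ {x̄, x̄ + 5p}` (the level-`10p` `β_y` cannot contain `5p`), i.e. `s = β_x`.
[cite: Shioda1982PicardFermat, Prop. 4 (Q′) p. 729] [cite: AokiShioda1983, §2 Theorem (𝔅²ₘ) (ii) a), b), p. 3] [cite: Aoki1983, Prop. 2.2] -/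
private theorem case_two_odd (h : Nat.Coprime 20 p) [NeZero (20 * p)] (hp : p.Prime) (h19 : 19 ≤ p)
    {s : Multiset (ZMod (20 * p))} (hs : IsHodgeMultiset s) (hpf : ∀ a ∈ s, ∀ b ∈ s.erase a, a + b ≠ 0)
    {x y z w : ZMod (20 * p)} (hsx : s = {x, y, z, w}) (hx1 : x.val % 2 = 1) (hy1 : y.val % 2 = 1)
    (hz0 : z.val % 2 = 0) (hw0 : w.val % 2 = 0) (hxc : (crt h x).2 ≠ 0) :
    s = {x, x + K20, -(2 * x), K20} ∨ s = {x, x + K20, 2 * x + K20, -(4 * x)} := by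
  classical
  haveI := Fact.mk hp
  have hp0 := hp.pos
  have hp2 : p % 2 = 1 := Nat.odd_iff.mp (hp.odd_of_ne_two (by omega))
  have h7 : 7 ≤ p := by omega
  haveI : NeZero (10 * p) := ⟨by omega⟩
  have hnm : 10 * p ∣ 20 * p := ⟨2, by ring⟩
  have hcard : Multiset.card s = 4 := by rw [hsx]; rfl
  have hx : x ∈ s := by rw [hsx]; simp
  have hy : y ∈ s.erase x := by rw [hsx, Multiset.insert_eq_cons, Multiset.erase_cons_head]; simp
  have hz : z ∈ s := by rw [hsx]; simp
  have hw : w ∈ s := by rw [hsx]; simp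
  have hz_ne : z ≠ 0 := hs.1.1 z hz
  have hw_ne : w ≠ 0 := hs.1.1 w hw
  -- Step 1: `y = x + 10p` by the relations on the odd part `{crt x, crt y}`
  have hRel := rels0_of_rels hp h19 (by rw [Multiset.card_map, hcard]) (rels_of_isHodgeMultiset h hp h7 hs)
  have hsw : s = {z, w, x, y} := by
    rw [hsx]; simp only [Multiset.insert_eq_cons, ← Multiset.singleton_add]; abel
  rw [hsw] at hRel
  simp only [Multiset.insert_eq_cons, Multiset.map_cons, Multiset.map_singleton] at hRel
  have hO := (hRel.of_cons_even (by rw [fst_val_mod_two]; exact hz0)).of_cons_even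
    (by rw [fst_val_mod_two]; exact hw0)
  have hex : (crt h x).1.val % 2 = 1 := by rw [fst_val_mod_two]; exact hx1
  have hey : (crt h y).1.val % 2 = 1 := by rw [fst_val_mod_two]; exact hy1
  have hyx : (((crt h y).1, (crt h y).2) : ZMod 20 × ZMod p) ≠ -((crt h x).1, (crt h x).2) := by
    rw [Prod.mk.eta, Prod.mk.eta, ← _root_.map_neg, (crt h).injective.ne_iff]
    intro e; exact hpf x hx y hy (by rw [e, add_neg_cancel])
  obtain ⟨he', hc'⟩ := two_odd_core hp h19 hO (e := (crt h x).1) (c := (crt h x).2) (e' := (crt h y).1)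
    (c' := (crt h y).2) (by simp only [Prod.mk.eta, Multiset.insert_eq_cons]) hex hey hxc hyx
  have hyK : y = x + K20 := by
    have e1 : pt h ((crt h x).1 + 10) (crt h x).2 = pt h (crt h x).1 (crt h x).2 + pt h 10 0 := by rw [pt_add, add_zero]
    rw [← pt_crt h y, he', hc', e1, pt_crt, tenP_eq_pt h hp h7]
  subst hyK
  -- Step 2: the transfer `T(s) = 2·{x̄, ẑ, ŵ}`
  have hxK1 : (x + K20).val % 2 = 1 := by
    rcases val_add_K hp0 x with ⟨e, -⟩ | ⟨e, -⟩ <;> omega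
  have hsplit : s = ({x, x + K20} : Multiset (ZMod (20 * p))) + {z, w} := by rw [hsx, pair_add_pair]
  have hT := isHodgeMultiset_transfer_twentyPrime hp0 hnm (so := {x, x + K20}) (se := {z, w})
    (by intro v hv; simp only [Multiset.insert_eq_cons, Multiset.mem_cons, Multiset.mem_singleton] at hv
        rcases hv with rfl | rfl <;> assumption)
    (by intro v hv; simp only [Multiset.insert_eq_cons, Multiset.mem_cons, Multiset.mem_singleton] at hv
        rcases hv with rfl | rfl <;> assumption)
    (hsplit ▸ hs)
  have hRK : ZMod.castHom hnm (ZMod (10 * p)) (x + K20) = ZMod.castHom hnm (ZMod (10 * p)) x := by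
    rw [_root_.map_add, map_natCast, ZMod.natCast_self, add_zero]
  simp only [Multiset.insert_eq_cons, Multiset.map_cons, Multiset.map_singleton, hRK] at hT
  set xb := ZMod.castHom hnm (ZMod (10 * p)) x with hxb
  set zt := ZMod.castHom hnm (ZMod (10 * p)) (half z) with hzt
  set wt := ZMod.castHom hnm (ZMod (10 * p)) (half w) with hwt
  have hxb0 : xb ≠ 0 := castHom_ne_zero_of_odd hnm hx1
  have hzt0 : zt ≠ 0 := castHom_half_ne_zero hnm hz_ne hz0
  have hwt0 : wt ≠ 0 := castHom_half_ne_zero hnm hw_ne hw0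
  have hK50 : K10 ≠ 0 := K10_ne_zero hp0
  have hxodd : xb.val % 2 = 1 := by rw [hxb, val_castHom_mod_two hnm, hx1]
  -- `x̄ ∉ pℤ/10p`
  set ρ := ZMod.castHom (dvd_mul_left p 10) (ZMod p) with hρ
  have hρR : ∀ v : ZMod (20 * p), ρ (ZMod.castHom hnm (ZMod (10 * p)) v) = (crt h v).2 := by
    intro v
    rw [crt_snd, hρ, ZMod.castHom_apply, ZMod.cast_eq_val, val_castHom, ZMod.natCast_eq_natCast_iff',
      Nat.mod_mod_of_dvd _ (dvd_mul_left p 10)]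
  have hρK : ρ K10 = 0 := by rw [map_natCast, Nat.cast_mul, ZMod.natCast_self, mul_zero]
  have hxbρ : ρ xb ≠ 0 := by rw [hxb, hρR]; exact hxc
  have hxbK : xb ≠ K10 := fun e ↦ hxbρ (by rw [e, hρK])
  -- norms and sum of `{x̄, ẑ, ŵ}`
  obtain ⟨⟨-, hTsum⟩, hTnorm⟩ := hT
  have hA : ∀ v : (ZMod (10 * p))ˣ,
      ((v : ZMod (10 * p)) * xb).val + ((v : ZMod (10 * p)) * zt).val + ((v : ZMod (10 * p)) * wt).val = 15 * p := by
    intro v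
    have e := hTnorm v
    simp only [Multiset.map_add, Multiset.map_cons, Multiset.map_singleton, mNormSum_add, mNormSum_cons,
      Multiset.card_add, Multiset.card_cons, Multiset.card_singleton] at e
    simp only [mNormSum, Multiset.map_singleton, Multiset.sum_singleton] at e
    omega
  have hsum3 : xb + zt + wt = K10 := by
    have h2 : (2 : ZMod (10 * p)) * (xb + zt + wt) = 0 := by
      simp only [Multiset.sum_add, Multiset.sum_cons, Multiset.sum_singleton] at hTsum
      linear_combination hTsum
    rcases (two_mul_eq_zero_tenP hp0).mp h2 with e | e
    · exfalso
      have h1 := hA 1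
      simp only [Units.val_one, one_mul] at h1
      have hcast : (((xb.val + zt.val + wt.val : ℕ)) : ZMod (10 * p)) = xb + zt + wt := by
        push_cast; simp only [ZMod.natCast_zmod_val]
      rw [h1, e, show ((15 * p : ℕ) : ZMod (10 * p)) = K10 + ((10 * p : ℕ) : ZMod (10 * p)) by push_cast; ring,
        ZMod.natCast_self, add_zero] at hcast
      exact hK50 hcast
    · exact e
  -- `τ = {x̄, ẑ, ŵ, 5p}` is a Hodge quadruple of level `10p`
  have hτ : IsHodgeMultiset ({xb, zt, wt, K10} : Multiset (ZMod (10 * p))) := by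
    refine ⟨⟨?_, ?_⟩, fun v ↦ ?_⟩
    · intro a ha
      simp only [Multiset.insert_eq_cons, Multiset.mem_cons, Multiset.mem_singleton] at ha
      rcases ha with rfl | rfl | rfl | rfl <;> assumption
    · simp only [Multiset.insert_eq_cons, Multiset.sum_cons, Multiset.sum_singleton]
      linear_combination hsum3 - neg_K10 (p := p)
    · have hvK : ((v : ZMod (10 * p)) * K10).val = 5 * p := by
        rw [unit_mul_natCast_half (m := 10 * p) (K := 5 * p) (by ring) v, val_K10 hp0]
      simp only [Multiset.insert_eq_cons, Multiset.map_cons, Multiset.map_singleton, mNormSum_cons, Multiset.card_cons,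
        Multiset.card_singleton]
      simp only [mNormSum, Multiset.map_singleton, Multiset.sum_singleton, hvK]
      have := hA v
      omega
  -- the doubles
  have hdx : dbl xb = 2 * x := dbl_castHom hnm x
  have hdz : dbl zt = z := dbl_castHom_half hnm hz0
  have hdw : dbl wt = w := dbl_castHom_half hnm hw0
  have hdK : dbl K10 = K20 := dbl_K10 hp0
  -- (i) `τ` has a pair: `s = α_x`
  by_cases h1 : xb + zt = 0
  · left
    have ezt : zt = -xb := by linear_combination h1
    have ewt : wt = K10 := by linear_combination hsum3 - h1
    have ez : z = -(2 * x) := by rw [← hdz, ezt, dbl_neg, hdx]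
    have ew : w = K20 := by rw [← hdw, ewt, hdK]
    rw [hsx, ez, ew]
  by_cases h2 : xb + wt = 0
  · left
    have ewt : wt = -xb := by linear_combination h2
    have ezt : zt = K10 := by linear_combination hsum3 - h2
    have ez : z = K20 := by rw [← hdz, ezt, hdK]
    have ew : w = -(2 * x) := by rw [← hdw, ewt, dbl_neg, hdx]
    rw [hsx, ez, ew]
    simp only [Multiset.insert_eq_cons, ← Multiset.singleton_add]; abel
  -- (ii) `τ` is pair-free: `τ = A_y`, `y ∈ {x̄, x̄ + 5p}`, and `s = β_x`
  right
  have h3 : zt + wt ≠ 0 := fun e ↦ hxbK (by linear_combination hsum3 - e)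
  have h4 : zt ≠ K10 := fun e ↦ h2 (by linear_combination hsum3 - e)
  have h5' : wt ≠ K10 := fun e ↦ h1 (by linear_combination hsum3 - e)
  have hτpf : ∀ a ∈ ({xb, zt, wt, K10} : Multiset (ZMod (10 * p))), ∀ b ∈ (({xb, zt, wt, K10} : Multiset (ZMod (10 * p)))).erase a,
      a + b ≠ 0 :=
    pairfree_quad h1 h2 (fun e ↦ hxbK (by linear_combination e + neg_K10 (p := p))) h3
      (fun e ↦ h4 (by linear_combination e + neg_K10 (p := p))) (fun e ↦ h5' (by linear_combination e + neg_K10 (p := p)))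
  have hc4 : Multiset.card ({xb, zt, wt, K10} : Multiset (ZMod (10 * p))) = 4 := rfl
  obtain ⟨y, hy⟩ := classify_hodgeMultiset_tenPrime hp h19 hτ hc4 hτpf
  rcases hy with e | e
  · -- type `α` (level `10p`): cancel `5p`
    have e3 : ({xb, zt, wt} : Multiset (ZMod (10 * p))) = {y, y + K10, -(2 * y)} := by
      have e' : ({xb, zt, wt} : Multiset (ZMod (10 * p))) + {K10} = {y, y + K10, -(2 * y)} + {K10} := by
        simpa only [Multiset.insert_eq_cons, Multiset.cons_add, Multiset.singleton_add] using e
      exact add_right_cancel e'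
    have hxmem3 : xb ∈ ({y, y + K10, -(2 * y)} : Multiset (ZMod (10 * p))) := by rw [← e3]; simp
    simp only [Multiset.insert_eq_cons, Multiset.mem_cons, Multiset.mem_singleton] at hxmem3
    obtain ⟨y', e4, hy'⟩ : ∃ y' : ZMod (10 * p),
        ({xb, zt, wt} : Multiset (ZMod (10 * p))) = {y', y' + K10, -(2 * y')} ∧ xb = y' := by
      rcases hxmem3 with e4 | e4 | e4
      · exact ⟨y, e3, e4⟩
      · refine ⟨y + K10, ?_, e4⟩
        rw [e3, show y + K10 + K10 = y by linear_combination -(neg_K10 (p := p)),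
          show -(2 * (y + K10)) = -(2 * y) by linear_combination neg_K10 (p := p)]
        simp only [Multiset.insert_eq_cons, ← Multiset.singleton_add]; abel
      · exfalso
        rw [e4, val_neg_mod_two_ten, val_two_mul_mod_two_ten] at hxodd
        omega
    rw [← hy'] at e4
    have e5 : ({zt, wt} : Multiset (ZMod (10 * p))) = {xb + K10, -(2 * xb)} := by
      simp only [Multiset.insert_eq_cons] at e4
      exact (Multiset.cons_inj_right _).mp e4
    have e6 := congrArg (Multiset.map dbl) e5
    simp only [Multiset.insert_eq_cons, Multiset.map_cons, Multiset.map_singleton, hdz, hdw, dbl_add, dbl_neg,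
      dbl_two_mul, hdx, hdK] at e6
    rw [hsx, show -(4 * x) = -(2 * (2 * x)) by ring]
    simp only [Multiset.insert_eq_cons]
    rw [e6]
  · -- type `β` (level `10p`): `5p ∈ β_y` is impossible
    exfalso
    have hmem : K10 ∈ ({y, y + K10, 2 * y + K10, -(4 * y)} : Multiset (ZMod (10 * p))) := by rw [← e]; simp
    have hne : ∀ a ∈ ({y, y + K10, 2 * y + K10, -(4 * y)} : Multiset (ZMod (10 * p))), a ≠ 0 := by rw [← e]; exact hτ.1.1
    have hy0 : y ≠ 0 := hne y (by simp)
    have hyK0 : y + K10 ≠ 0 := hne (y + K10) (by simp)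
    simp only [Multiset.insert_eq_cons, Multiset.mem_cons, Multiset.mem_singleton] at hmem
    rcases hmem with e' | e' | e' | e'
    · exact hyK0 (by rw [← e']; linear_combination -(neg_K10 (p := p)))
    · exact hy0 (by linear_combination -e')
    · have h2y : (2 : ZMod (10 * p)) * y = 0 := by linear_combination -e'
      rcases (two_mul_eq_zero_tenP hp0).mp h2y with e'' | e''
      · exact hy0 e''
      · exact hyK0 (by rw [e'']; linear_combination -(neg_K10 (p := p)))
    · -- `4y = 5p` is impossible modulo `2` (`p` odd)
      have e4 : (4 : ZMod (10 * p)) * y = K10 := by linear_combination e' + neg_K10 (p := p)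
      have h4 := congrArg (ZMod.castHom (⟨5 * p, by ring⟩ : 2 ∣ 10 * p) (ZMod 2)) e4
      rw [_root_.map_mul, map_ofNat, map_natCast, show (4 : ZMod 2) = 0 from by decide, zero_mul, eq_comm,
        ZMod.natCast_eq_zero_iff] at h4
      omega

/-! ### Case III: four odd members -/

/-- **All members odd, one off the fibre `0`: impossible.** `s̄ = s mod 10p` is a Hodge quadruple of level `10p` with odd
members; it has a pair (the level-`10p` types `α`, `β` have an even member), so `s = {u₁, 10p − u₁, u₃, 10p − u₃}`, which violates
the relations (`halfpair_odd`). [cite: AokiShioda1983, §2 Theorem (𝔅²ₘ) (ii), p. 3] [cite: Aoki1983, Prop. 2.2] -/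
private theorem case_all_odd (h : Nat.Coprime 20 p) [NeZero (20 * p)] (hp : p.Prime) (h19 : 19 ≤ p)
    {s : Multiset (ZMod (20 * p))} (hs : IsHodgeMultiset s) (hcard : Multiset.card s = 4)
    (hpf : ∀ a ∈ s, ∀ b ∈ s.erase a, a + b ≠ 0) (hodd : ∀ w ∈ s, w.val % 2 = 1) (hex : ∃ w ∈ s, (crt h w).2 ≠ 0) :
    False := by
  classical
  haveI := Fact.mk hp
  have hp0 := hp.pos
  have h7 : 7 ≤ p := by omega
  haveI : NeZero (10 * p) := ⟨by omega⟩
  have hnm : 10 * p ∣ 20 * p := ⟨2, by ring⟩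
  have hT := isHodgeMultiset_transfer_twentyPrime hp0 hnm (so := s) (se := 0) hodd (by simp) (by simpa using hs)
  simp only [Multiset.map_zero, add_zero] at hT
  have hc4 : Multiset.card (s.map (ZMod.castHom hnm (ZMod (10 * p)))) = 4 := by rw [Multiset.card_map, hcard]
  have hRel := rels0_of_rels hp h19 (by rw [Multiset.card_map, hcard]) (rels_of_isHodgeMultiset h hp h7 hs)
  have hRodd : ∀ a ∈ s.map (ZMod.castHom hnm (ZMod (10 * p))), a.val % 2 = 1 := by
    intro a ha
    obtain ⟨w, hw, rfl⟩ := Multiset.mem_map.mp ha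
    rw [val_castHom_mod_two hnm, hodd w hw]
  by_cases hpair : ∀ a ∈ s.map (ZMod.castHom hnm (ZMod (10 * p))),
      ∀ b ∈ (s.map (ZMod.castHom hnm (ZMod (10 * p)))).erase a, a + b ≠ 0
  · -- `s̄` pair-free: `α_y` or `β_y`, both with an even member
    obtain ⟨y, hy⟩ := classify_hodgeMultiset_tenPrime hp h19 hT hc4 hpair
    rcases hy with e | e
    · have := hRodd (-(2 * y)) (by rw [e]; simp)
      rw [val_neg_mod_two_ten, val_two_mul_mod_two_ten] at this
      omega
    · have := hRodd (-(4 * y)) (by rw [e]; simp)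
      rw [val_neg_mod_two_ten, show (4 : ZMod (10 * p)) * y = 2 * (2 * y) by ring, val_two_mul_mod_two_ten] at this
      omega
  · -- `s̄` has a pair: `s = {u₁, 10p − u₁, u₃, 10p − u₃}`
    push Not at hpair
    obtain ⟨a, ha, b, hb, hab⟩ := hpair
    obtain ⟨u₁, hu₁, rfl⟩ := Multiset.mem_map.mp ha
    rw [← Multiset.map_erase_of_mem _ _ hu₁] at hb
    obtain ⟨u₂, hu₂, rfl⟩ := Multiset.mem_map.mp hb
    have hK0 : ZMod.castHom hnm (ZMod (10 * p)) K20 = 0 := by rw [map_natCast, ZMod.natCast_self]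
    rcases lift_eq hp0 hnm (a := u₂) (b := -u₁) (by rw [_root_.map_neg]; linear_combination hab) with e2 | e2
    · exact hpf u₁ hu₁ u₂ hu₂ (by rw [e2, add_neg_cancel])
    -- the other two members
    obtain ⟨t, ht⟩ : ∃ t, s = u₁ ::ₘ u₂ ::ₘ t := by
      obtain ⟨t, ht⟩ := Multiset.exists_cons_of_mem hu₂
      exact ⟨t, by rw [← Multiset.cons_erase hu₁, ht]⟩
    have hct : Multiset.card t = 2 := by
      rw [ht, Multiset.card_cons, Multiset.card_cons] at hcard; omega
    obtain ⟨u₃, u₄, rfl⟩ := Multiset.card_eq_two.mp hct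
    have hu₃ : u₃ ∈ s := by rw [ht]; simp
    have hu₄ : u₄ ∈ s.erase u₃ := by
      rw [ht, show u₁ ::ₘ u₂ ::ₘ ({u₃, u₄} : Multiset (ZMod (20 * p))) = u₃ ::ₘ u₁ ::ₘ u₂ ::ₘ {u₄} by
        simp only [Multiset.insert_eq_cons, ← Multiset.singleton_add]; abel, Multiset.erase_cons_head]
      simp
    have hτ : IsHodgeMultiset ({ZMod.castHom hnm (ZMod (10 * p)) u₃, ZMod.castHom hnm (ZMod (10 * p)) u₄} :
        Multiset (ZMod (10 * p))) := by
      have e3 : s.map (ZMod.castHom hnm (ZMod (10 * p))) = ZMod.castHom hnm (ZMod (10 * p)) u₁ ::ₘ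
          (-ZMod.castHom hnm (ZMod (10 * p)) u₁) ::ₘ {ZMod.castHom hnm (ZMod (10 * p)) u₃, ZMod.castHom hnm (ZMod (10 * p)) u₄} := by
        rw [ht]
        simp only [Multiset.map_cons, Multiset.insert_eq_cons, Multiset.map_singleton, e2, _root_.map_add, _root_.map_neg, hK0, add_zero]
      rw [e3] at hT
      exact isHodgeMultiset_of_cons_cons_neg hT
    have e4 := eq_neg_of_isHodgeMultiset_pair hτ
    rcases lift_eq hp0 hnm (a := u₄) (b := -u₃) (by rw [_root_.map_neg]; exact e4) with e5 | e5
    · exact hpf u₃ hu₃ u₄ hu₄ (by rw [e5, add_neg_cancel])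
    -- order the two half-pairs so that the first is off the fibre `0`
    have hsw : s = {u₁, -u₁ + K20, u₃, -u₃ + K20} := by rw [ht, e2, e5]; rfl
    have hord : ∃ v₁ v₃ : ZMod (20 * p), (crt h v₁).2 ≠ 0 ∧ s = {v₁, -v₁ + K20, v₃, -v₃ + K20} := by
      by_cases h₁ : (crt h u₁).2 ≠ 0
      · exact ⟨u₁, u₃, h₁, hsw⟩
      · push Not at h₁
        refine ⟨u₃, u₁, ?_, by rw [hsw]; simp only [Multiset.insert_eq_cons, ← Multiset.singleton_add]; abel⟩
        obtain ⟨w, hw, hw0⟩ := hex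
        rw [hsw] at hw
        have hK2 : (crt h K20).2 = 0 := by rw [tenP_eq_pt h hp h7, crt_pt]
        simp only [Multiset.insert_eq_cons, Multiset.mem_cons, Multiset.mem_singleton] at hw
        rcases hw with rfl | rfl | rfl | rfl
        · exact absurd h₁ hw0
        · exfalso; apply hw0; rw [_root_.map_add, Prod.snd_add, _root_.map_neg, Prod.snd_neg, h₁, hK2, neg_zero, add_zero]
        · exact hw0
        · intro h₃; apply hw0; rw [_root_.map_add, Prod.snd_add, _root_.map_neg, Prod.snd_neg, h₃, hK2, neg_zero, add_zero]
    obtain ⟨v₁, v₃, hc, hsv⟩ := hord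
    have hv₁ : v₁ ∈ s := by rw [hsv]; simp
    have hv₃ : v₃ ∈ s.erase v₁ := by rw [hsv, Multiset.insert_eq_cons, Multiset.erase_cons_head]; simp
    have hv₃' : -v₃ + K20 ∈ s.erase v₁ := by rw [hsv, Multiset.insert_eq_cons, Multiset.erase_cons_head]; simp
    have hv₃s : v₃ ∈ s := Multiset.mem_of_mem_erase hv₃
    obtain ⟨e₀, c, rfl⟩ : ∃ e₀ c, v₁ = pt h e₀ c := ⟨_, _, (pt_crt h v₁).symm⟩
    obtain ⟨f, c', rfl⟩ : ∃ f c', v₃ = pt h f c' := ⟨_, _, (pt_crt h v₃).symm⟩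
    simp only [crt_pt] at hc
    have he₀ : e₀.val % 2 = 1 := by rw [← val_pt_mod_two h e₀ c]; exact hodd _ hv₁
    have hf : f.val % 2 = 1 := by rw [← val_pt_mod_two h f c']; exact hodd _ hv₃s
    have hK' : ∀ (e : ZMod 20) (b : ZMod p), -(pt h e b) + K20 = pt h (10 - e) (-b) := by
      intro e b
      rw [tenP_eq_pt h hp h7, neg_pt, pt_add, add_zero, show -e + 10 = 10 - e by ring]
    have hz1 : ((f, c') : ZMod 20 × ZMod p) ≠ -(e₀, c) := by
      intro hq
      apply hpf _ hv₁ _ hv₃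
      have : crt h (pt h f c') = crt h (-(pt h e₀ c)) := by rw [crt_pt, _root_.map_neg, crt_pt]; exact hq
      have := (crt h).injective this
      rw [this, add_neg_cancel]
    have hz2 : ((10 - f, -c') : ZMod 20 × ZMod p) ≠ -(e₀, c) := by
      intro hq
      apply hpf _ hv₁ _ hv₃'
      have : crt h (-(pt h f c') + K20) = crt h (-(pt h e₀ c)) := by rw [hK', crt_pt, _root_.map_neg, crt_pt]; exact hq
      have := (crt h).injective this
      rw [this, add_neg_cancel]
    refine halfpair_odd hp h19 he₀ hf hc ?_ hz1 hz2
    rw [hsv, hK', hK'] at hRel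
    simp only [Multiset.insert_eq_cons, Multiset.map_cons, Multiset.map_singleton, crt_pt] at hRel
    exact hRel

/-! ### Assembly -/

/-- **Classification of the pair-free Hodge `4`-multisets of level `20p`, `p ≥ 19` prime** (multiset form of Shioda's Prop. 4 (Q′) /
Aoki–Shioda's Theorem (𝔅²ₘ) (ii) at `m = 20p`, together with the level-`20` exceptional quadruples). A pair-free Hodge
`4`-multiset over `ℤ/20p` is `{x, x + 10p, −2x, 10p}` (type `α`, `m′ = 10p`) or `{x, x + 10p, 2x + 10p, −4x}` (type `β`) for some
residue `x`, or `x·r` with `x = t p`, `t` a unit of `ℤ/20`, and `r` one of the four exceptional quadruples of level `20` printed in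
Tabelle 1 — `(1, 4, 17, 18)`, `(1, 6, 16, 17)`, `(1, 9, 13, 17)`, `(1, 10, 12, 17)` (orbits of sizes `8, 8, 2, 8`: Shioda's
`Δ(20) = 26`). PROOF: the character relations `Z1`, `Z3`, `Γ₋₄χ₅`, `Γ₋₄` of `KoblitzOgusRelationsTwentyPrime` (from
`KoblitzOgus.hodge_eq_combination`), the transfer to level `10p` (`isHodgeMultiset_transfer_twentyPrime` +
`classify_hodgeMultiset_tenPrime`) and the norm equations at the units `pt(1, λ)`, by the number of odd members: `fibre_zero`,
`case_all_even`, `case_two_odd`, `case_two_odd_fibre`, `case_all_odd`.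
[cite: Shioda1982PicardFermat, §4 Lemma 1 p. 728, Prop. 4 (Q′) p. 729 and table p. 727 (m = 20)]
[cite: AokiShioda1983, §2 Theorem (𝔅²ₘ) (ii) a), b), p. 3] [cite: MeyerNeutsch1981Fermatquadrupel, Tabelle 1 p. 54 (N = 20)]
[cite: Aoki1983, Prop. 2.2] [cite: Deligne1982HodgeCycles, Rem. 7.16 (a)] -/
theorem classify_hodgeMultiset_twentyPrime [NeZero (20 * p)] (hp : p.Prime) (h19 : 19 ≤ p)
    {s : Multiset (ZMod (20 * p))} (hs : IsHodgeMultiset s) (hcard : Multiset.card s = 4)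
    (hind : ∀ a ∈ s, ∀ b ∈ s.erase a, a + b ≠ 0) :
    ∃ x : ZMod (20 * p), s = {x, x + K20, -(2 * x), K20} ∨ s = {x, x + K20, 2 * x + K20, -(4 * x)} ∨
      ((∃ t : ℕ, (t = 1 ∨ t = 3 ∨ t = 7 ∨ t = 9 ∨ t = 11 ∨ t = 13 ∨ t = 17 ∨ t = 19) ∧ x = ((t * p : ℕ) : ZMod (20 * p))) ∧
        (s = {x, 4 * x, 17 * x, 18 * x} ∨ s = {x, 6 * x, 16 * x, 17 * x} ∨ s = {x, 9 * x, 13 * x, 17 * x} ∨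
          s = {x, 10 * x, 12 * x, 17 * x})) := by
  classical
  have h7 : 7 ≤ p := by omega
  have h := coprime_twenty hp h7
  -- the fibre `0`
  by_cases hex : ∃ w ∈ s, (crt h w).2 ≠ 0
  swap
  · push Not at hex
    exact fibre_zero h hp h19 hs hcard hind hex
  -- split by parity
  set so := s.filter fun w ↦ w.val % 2 = 1 with hso
  set se := s.filter fun w ↦ ¬ w.val % 2 = 1 with hse
  have hsplit : s = so + se := (Multiset.filter_add_not _ s).symm
  have hcs : Multiset.card so + Multiset.card se = 4 := by rw [← Multiset.card_add, ← hsplit, hcard]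
  have heven : Even (Multiset.card so) := even_card_filter_odd hs.1.2
  have hso1 : ∀ v ∈ so, v.val % 2 = 1 := fun v hv ↦ (Multiset.mem_filter.mp hv).2
  have hse0 : ∀ v ∈ se, v.val % 2 = 0 := fun v hv ↦ by have := (Multiset.mem_filter.mp hv).2; omega
  obtain ⟨k, hk⟩ := heven
  have hk2 : k ≤ 2 := by omega
  interval_cases k
  · -- no odd member
    have h0 : so = 0 := Multiset.card_eq_zero.mp (by omega)
    rw [h0, zero_add] at hsplit
    obtain ⟨x, hx⟩ := case_all_even hp h19 hs hcard hind fun v hv ↦ hse0 v (hsplit ▸ hv)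
    refine ⟨x, ?_⟩
    rcases hx with hx | hx
    · exact Or.inl hx
    · exact Or.inr (Or.inl hx)
  · -- two odd members
    have h2 : Multiset.card so = 2 := by omega
    have h2' : Multiset.card se = 2 := by omega
    obtain ⟨x, y, hxy⟩ := Multiset.card_eq_two.mp h2
    obtain ⟨z, w, hzw⟩ := Multiset.card_eq_two.mp h2'
    have hx1 : x.val % 2 = 1 := hso1 x (by rw [hxy]; simp)
    have hy1 : y.val % 2 = 1 := hso1 y (by rw [hxy]; simp)
    have hz0 : z.val % 2 = 0 := hse0 z (by rw [hzw]; simp)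
    have hw0 : w.val % 2 = 0 := hse0 w (by rw [hzw]; simp)
    have hsx : s = {x, y, z, w} := by rw [hsplit, hxy, hzw, pair_add_pair]
    by_cases hxc : (crt h x).2 ≠ 0
    · rcases case_two_odd h hp h19 hs hind hsx hx1 hy1 hz0 hw0 hxc with e | e
      · exact ⟨x, Or.inl e⟩
      · exact ⟨x, Or.inr (Or.inl e)⟩
    by_cases hyc : (crt h y).2 ≠ 0
    · have hsy : s = {y, x, z, w} := by
        rw [hsx]; simp only [Multiset.insert_eq_cons]; exact Multiset.cons_swap x y _
      rcases case_two_odd h hp h19 hs hind hsy hy1 hx1 hz0 hw0 hyc with e | e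
      · exact ⟨y, Or.inl e⟩
      · exact ⟨y, Or.inr (Or.inl e)⟩
    push Not at hxc hyc
    exfalso
    by_cases hzc : (crt h z).2 ≠ 0
    · exact case_two_odd_fibre h hp h19 hs hind hsx hz0 hw0 hxc hyc hzc
    push Not at hzc
    have hwc : (crt h w).2 ≠ 0 := by
      obtain ⟨v, hv, hvc⟩ := hex
      rw [hsx] at hv
      simp only [Multiset.insert_eq_cons, Multiset.mem_cons, Multiset.mem_singleton] at hv
      rcases hv with rfl | rfl | rfl | rfl
      · exact absurd hxc hvc
      · exact absurd hyc hvc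
      · exact absurd hzc hvc
      · exact hvc
    have hsw : s = {x, y, w, z} := by rw [hsx, Multiset.pair_comm z w]
    exact case_two_odd_fibre h hp h19 hs hind hsw hw0 hz0 hxc hyc hwc
  · -- four odd members
    have h0 : se = 0 := Multiset.card_eq_zero.mp (by omega)
    rw [h0, add_zero] at hsplit
    exact (case_all_odd h hp h19 hs hcard hind (fun v hv ↦ hso1 v (hsplit ▸ hv)) hex).elim

end TwentyPrimeClassification

end Literature.AlgebraicGeometry.Shioda1982
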